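import Literature.ModelTheory.ExponentialFields.Wilkie1989Lemma3
import Mathlib.Algebra.Polynomial.Derivative
import Mathlib.Algebra.Polynomial.Inductions
import Mathlib.Algebra.Polynomial.Roots
import Mathlib.RingTheory.Polynomial.Basic
import Mathlib.Algebra.Polynomial.EraseLead
import Mathlib.Order.Interval.Set.Infinite
import HarnessLib

/-!
# Wilkie 1989: the ring `k[x̄]ᵉ`, the tower `Mᵢ`, and the proof of Lemma 1 (hence Lemma 3, Corollary 1)

Trunk `TranscendEllArithS`, family `periods` (periods.S28): discharge of the named facts
`Literature.ModelTheory.ExponentialFields.Wilkie1989_lemma1` (`Wilkie1989Lemma3.lean`), `Literature.ModelTheory.ExponentialFields.Wilkie1989_lemma3` and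
`Literature.ModelTheory.ExponentialFields.Wilkie1989_cor1` (`Wilkie1989.lean`) of the decomposition of `Literature.ModelTheory.ExponentialFields.wilkie_isModelComplete`,
following A. J. Wilkie, *On the theory of the real exponential field*, Illinois J. Math. 33
(1989), §1 (p. 385), §3 (pp. 390–395) and the printed proof of Lemma 1 (pp. 391–395).
Everything here is proved; the calculus facts used "by transfer" (§2 and continuity) are in
`Wilkie1989Sec2.lean` and `RealExpLagrange.lean`.

## Part I: `k[x̄]ᵉ`, its derivations, admissible chains and the tower (§1, §3)

* p. 385: `k[x̄]ᵉ`, "the set of all terms of `L(k)` in the variables `x₁, …, xₙ` factored by the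
  equivalence relation `f ≡ g ⟺ T ⊢ ∀x̄ f = g`", identified "with the corresponding functions on
  `k` (or on `K`)".  Here: the subring `RealExpModel.termFnRing f n` of the ring of functions
  `Kⁿ → K` consisting of the functions defined by exponential terms with parameters from `k`
  (`K ⊨ T_exp` a model, `f : k ↪ K`), with its derivations `∂/∂xᵢ` (`RealExpModel.pd`, well
  defined by `realize_termPDeriv_congr`, `Wilkie1989Sec2.lean`): "`k[x̄]ᵉ` also admits a
  differential structure".
* p. 391: "Let us suppose that `k` is countable. We define `Mᵢ = k[x₁, …, xᵢ]` for `0 ≤ i ≤ n`,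
  and `Mᵢ₊₁ = Mᵢ[e^{gᵢ}]` for `i ≥ n`, where each `gᵢ ∈ Mᵢ` is chosen in some way so that
  `k[x̄]ᵉ = ⋃ᵢ Mᵢ`. Clearly this is possible and note that each `Mᵢ` … is closed under partial
  differentiation."  Here: `RealExpModel.tower` (subrings of `termFnRing`, each a polynomial
  extension `Mᵢ[Yᵢ]` of the previous one, `RealExpModel.towerGen`), monotone
  (`tower_mono`), closed under the derivations (`pd_mem_tower`), depending only on
  `x₁, …, xⱼ` for `j ≤ n` (`apply_eq_of_mem_tower`), and exhausting `k[x̄]ᵉ`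
  (`exists_mem_tower`), the `gᵢ` being chosen by a least-index rule along an enumeration of the
  (countably many) terms.
* Degrees in `Mⱼ₊₁ = Mⱼ[Yⱼ]` ("`h ∈ M` has degree `≤ s` if `h = Σᵢ₌₀ˢ aᵢ e^{ig}`", p. 395) via
  representing polynomials over `Mⱼ` (Mathlib's `Polynomial`), with the derivative formula
  `pd_eval` and pseudo-division (`exists_pseudo_division`, "by the Euclidean algorithm", p. 393).

Everything here is proved.

## Part II: the proof of Lemma 1 (pp. 391–395)

"Suppose we have proved the lemma with `Mⱼ` in place of `k[x̄]ᵉ` … We wish to extend the set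
`{h₁, …, hₚ}` so that (1)ⱼ₊₁, (2)ⱼ₊₁ and (3)ⱼ₊₁ are satisfied for the extended set.
Case 1. (3)ⱼ₊₁ is satisfied with the same `h₁, …, hₚ` … Case 2. Not Case 1. Then there is some
`h ∈ Mⱼ₊₁` [vanishing at a point of `S ∩ Vⁿˢ(h₁, …, hₚ)` but not vanishing on `V(h₁, …, hₚ)` close
to it; choose one of minimal degree `s`] … Subcase 2(a): `j < n` [`Mⱼ₊₁ = Mⱼ[xⱼ₊₁]`: the
derivative `∂h/∂xⱼ₊₁` has degree `< s`, vanishes at the point, hence close to it, hence the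
polynomial `Σ i aᵢ(β̄) xⱼ₊₁ⁱ⁻¹` is identically zero …] … Subcase 2(b): `j ≥ n`
[`Mⱼ₊₁ = Mⱼ[e^g]`: the coefficients of `τ = a₀ (ω ∧ dh) - h (ω ∧ da₀)` are of the form
`e^g q(e^g)` with `deg q < s` …, and by §2 `h/a₀` is constant, hence `0`, close to the point …].
To show (3)ⱼ₊₁ … by the Euclidean algorithm `aₛᵐ H = F₁ h + F₂` … This completes our inductive
construction, which clearly implies the lemma, since for some `J₀`, Case 1 must hold for all
`j ≥ J₀` and every `g ∈ k[x̄]ᵉ` lies in some `Mⱼ`."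

The tower `Mⱼ`, degrees and pseudo-division are in `Wilkie1989Tower.lean`; the calculus facts
used "by transfer" (§2 and continuity) in `Wilkie1989Sec2.lean` and `RealExpLagrange.lean`.
Here: the extension step (`RealExpModel.lemma1_step`, Case 2 with both subcases
`RealExpModel.MinBad.jrow_not_mem_span_of_lt` / `_of_le` and the proof of (3)ⱼ₊₁,
`RealExpModel.MinBad.clause3_snoc`), the induction in the form "a good system with the maximal
number `p` of equations satisfies (3)ⱼ for all `j`" (`RealExpModel.clause3_of_maximal`,
`RealExpModel.lemma1_main`), and the theorems `Literature.ModelTheory.ExponentialFields.Wilkie1989_lemma1_holds`,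
`Literature.ModelTheory.ExponentialFields.Wilkie1989_lemma3_holds`, `Literature.ModelTheory.ExponentialFields.Wilkie1989_cor1_holds`.

## References

* A. J. Wilkie, *On the theory of the real exponential field*, Illinois J. Math. 33 (1989),
  384–408: §1 p. 385; §3 pp. 390–395 (Lemma 1 and its proof, the tower p. 391, degrees p. 395,
  the Euclidean algorithm p. 393); Lemma 3, p. 396; Corollary 1, p. 398.
-/

noncomputable section

open FirstOrder FirstOrder.Language FirstOrder.Language.Structure
open Polynomial

namespace Literature.ModelTheory.ExponentialFields

namespace RealExpModel

variable {k K : Language.Theory.ModelType.{0, 0, 0} realExpTheory}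
  (f : k ↪[Language.orderedExpRing] K) (n : ℕ)

/-! ### The ring `k[x̄]ᵉ` of term functions and its derivations -/

/-- The function `Kⁿ → K` defined by a term with parameters from `k` (Wilkie 1989, p. 385:
terms identified "with the corresponding functions … on `K`"). [cite: Wilkie1989, §1, p. 385] -/
def termFn (t : Language.orderedExpRing.Term (k ⊕ Fin n)) : (Fin n → K) → K :=
  fun x => t.realize (Sum.elim f x)

/-- Unfolding of `termFn`. [folklore] -/
@[simp] theorem termFn_apply (t : Language.orderedExpRing.Term (k ⊕ Fin n)) (x : Fin n → K) :
    termFn f n t x = t.realize (Sum.elim f x) := rfl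

/-- **`k[x̄]ᵉ` as a ring of functions** (Wilkie 1989, p. 385): the subring of `Kⁿ → K` of functions
defined by exponential terms with parameters from `k`. [cite: Wilkie1989, §1, p. 385] -/
def termFnRing : Subring ((Fin n → K) → K) where
  carrier := {F | ∃ t : Language.orderedExpRing.Term (k ⊕ Fin n), termFn f n t = F}
  mul_mem' := by
    rintro _ _ ⟨t₁, rfl⟩ ⟨t₂, rfl⟩
    exact ⟨t₁ * t₂, funext fun x => by simp⟩
  one_mem' := ⟨1, funext fun x => by simp⟩
  add_mem' := by
    rintro _ _ ⟨t₁, rfl⟩ ⟨t₂, rfl⟩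
    exact ⟨t₁ + t₂, funext fun x => by simp⟩
  zero_mem' := ⟨0, funext fun x => by simp⟩
  neg_mem' := by
    rintro _ ⟨t, rfl⟩
    exact ⟨-t, funext fun x => by simp⟩

variable {f n}

/-- Membership in `k[x̄]ᵉ`. [folklore] -/
theorem mem_termFnRing {F : (Fin n → K) → K} :
    F ∈ termFnRing f n ↔ ∃ t : Language.orderedExpRing.Term (k ⊕ Fin n), termFn f n t = F :=
  Iff.rfl

variable (f n)

/-- The element of `k[x̄]ᵉ` defined by a term. [folklore] -/
def fnOf (t : Language.orderedExpRing.Term (k ⊕ Fin n)) : termFnRing f n :=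
  ⟨termFn f n t, t, rfl⟩

/-- Values of `fnOf`. [folklore] -/
@[simp] theorem coe_fnOf (t : Language.orderedExpRing.Term (k ⊕ Fin n)) :
    ((fnOf f n t : termFnRing f n) : (Fin n → K) → K) = termFn f n t := rfl

/-- Every element of `k[x̄]ᵉ` is `fnOf` of some term. [folklore] -/
theorem exists_fnOf_eq (F : termFnRing f n) : ∃ t, fnOf f n t = F := by
  obtain ⟨t, ht⟩ := F.2
  exact ⟨t, Subtype.ext ht⟩

/-- A term representing an element of `k[x̄]ᵉ`. [folklore] -/
def reprTerm (F : termFnRing f n) : Language.orderedExpRing.Term (k ⊕ Fin n) :=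
  Classical.choose F.2

/-- The representing term represents. [folklore] -/
@[simp] theorem termFn_reprTerm (F : termFnRing f n) : termFn f n (reprTerm f n F) = F :=
  Classical.choose_spec F.2

/-- The representing term represents (pointwise). [folklore] -/
theorem realize_reprTerm (F : termFnRing f n) (x : Fin n → K) :
    (reprTerm f n F).realize (Sum.elim f x) = (F : (Fin n → K) → K) x :=
  congrFun (termFn_reprTerm f n F) x

/-- **The derivations `∂/∂xₗ` of `k[x̄]ᵉ`** (Wilkie 1989, p. 385), via formal partial derivatives of
representing terms; well defined because `∂/∂xₗ` respects equality of term functions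
(`realize_termPDeriv_congr`, by transfer). [cite: Wilkie1989, §1, p. 385] -/
def pd (l : Fin n) (F : termFnRing f n) : termFnRing f n :=
  fnOf f n (termPDeriv l (reprTerm f n F))

/-- `∂/∂xₗ` of the function of a term is the function of `∂t/∂xₗ`. [cite: Wilkie1989, §1, p. 385] -/
theorem pd_fnOf (l : Fin n) (t : Language.orderedExpRing.Term (k ⊕ Fin n)) :
    pd f n l (fnOf f n t) = fnOf f n (termPDeriv l t) := by
  apply Subtype.ext
  funext x
  show (termPDeriv l (reprTerm f n (fnOf f n t))).realize (Sum.elim f x) =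
    (termPDeriv l t).realize (Sum.elim f x)
  exact realize_termPDeriv_congr K f l _ t (fun y => realize_reprTerm f n (fnOf f n t) y) x

/-- Values of `∂F/∂xₗ` through any representing term. [folklore] -/
theorem coe_pd_of_eq (l : Fin n) {F : termFnRing f n} {t : Language.orderedExpRing.Term (k ⊕ Fin n)}
    (ht : fnOf f n t = F) (x : Fin n → K) :
    ((pd f n l F : termFnRing f n) : (Fin n → K) → K) x = (termPDeriv l t).realize (Sum.elim f x) := by
  subst ht
  rw [pd_fnOf]
  rfl

/-- Sum rule. [cite: Wilkie1989, §1, p. 385] -/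
@[simp] theorem pd_add (l : Fin n) (F G : termFnRing f n) : pd f n l (F + G) = pd f n l F + pd f n l G := by
  obtain ⟨t₁, rfl⟩ := exists_fnOf_eq f n F
  obtain ⟨t₂, rfl⟩ := exists_fnOf_eq f n G
  have e : fnOf f n t₁ + fnOf f n t₂ = fnOf f n (t₁ + t₂) := Subtype.ext (funext fun x => by simp)
  rw [e, pd_fnOf, pd_fnOf, pd_fnOf, termPDeriv_add]
  exact Subtype.ext (funext fun x => by simp)

/-- Leibniz rule. [cite: Wilkie1989, §1, p. 385] -/
@[simp] theorem pd_mul (l : Fin n) (F G : termFnRing f n) :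
    pd f n l (F * G) = pd f n l F * G + F * pd f n l G := by
  obtain ⟨t₁, rfl⟩ := exists_fnOf_eq f n F
  obtain ⟨t₂, rfl⟩ := exists_fnOf_eq f n G
  have e : fnOf f n t₁ * fnOf f n t₂ = fnOf f n (t₁ * t₂) := Subtype.ext (funext fun x => by simp)
  rw [e, pd_fnOf, pd_fnOf, pd_fnOf, termPDeriv_mul]
  exact Subtype.ext (funext fun x => by simp)

/-- `∂(-F)/∂xₗ = -∂F/∂xₗ`. [cite: Wilkie1989, §1, p. 385] -/
@[simp] theorem pd_neg (l : Fin n) (F : termFnRing f n) : pd f n l (-F) = -pd f n l F := by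
  obtain ⟨t, rfl⟩ := exists_fnOf_eq f n F
  have e : -fnOf f n t = fnOf f n (-t) := Subtype.ext (funext fun x => by simp)
  rw [e, pd_fnOf, pd_fnOf, termPDeriv_neg]
  exact Subtype.ext (funext fun x => by simp)

/-- `∂0/∂xₗ = 0`. [folklore] -/
@[simp] theorem pd_zero (l : Fin n) : pd f n l (0 : termFnRing f n) = 0 := by
  have := pd_add f n l (0 : termFnRing f n) 0
  simpa using this

/-- `∂1/∂xₗ = 0`. [folklore] -/
@[simp] theorem pd_one (l : Fin n) : pd f n l (1 : termFnRing f n) = 0 := by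
  have e : (1 : termFnRing f n) = fnOf f n 1 := Subtype.ext (funext fun x => by simp)
  rw [e, pd_fnOf, ExpTerm.termPDeriv_one]
  exact Subtype.ext (funext fun x => by simp)

/-- `∂(F - G)/∂xₗ`. [folklore] -/
@[simp] theorem pd_sub (l : Fin n) (F G : termFnRing f n) : pd f n l (F - G) = pd f n l F - pd f n l G := by
  rw [sub_eq_add_neg, pd_add, pd_neg, sub_eq_add_neg]

/-! ### Identities of abstract derivations

The identities below are proved for an arbitrary additive map `D` satisfying the Leibniz rule on a
commutative ring (so that `ring` works with opaque atoms) and then specialized to `∂/∂xₗ`. -/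

section Derivation

variable {R : Type*} [CommRing R] (D : R → R) (hadd : ∀ a b, D (a + b) = D a + D b)
  (hmul : ∀ a b, D (a * b) = D a * b + a * D b)
include hadd hmul

omit hadd in
/-- A Leibniz map kills `1`. [folklore] -/
theorem derivation_one : D 1 = 0 := by
  have h := hmul 1 1
  rw [one_mul, mul_one, one_mul] at h
  -- h : D 1 = D 1 + D 1
  have : D 1 + D 1 = D 1 + 0 := by rw [add_zero]; exact h.symm
  exact add_left_cancel this

omit hmul in
/-- A Leibniz map kills `0`. [folklore] -/
theorem derivation_zero : D 0 = 0 := by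
  have h := hadd 0 0
  rw [add_zero] at h
  have : D 0 + D 0 = D 0 + 0 := by rw [add_zero]; exact h.symm
  exact add_left_cancel this

omit hadd in
/-- Power rule for a Leibniz map. [folklore] -/
theorem derivation_pow (a : R) (m : ℕ) : D (a ^ m) = (m : R) * a ^ (m - 1) * D a := by
  induction m with
  | zero => rw [pow_zero, derivation_one D hmul, Nat.cast_zero, zero_mul, zero_mul]
  | succ m ih =>
    rw [pow_succ, hmul, ih, Nat.add_sub_cancel]
    rcases m with _ | m
    · simp
    · rw [Nat.add_sub_cancel]; push_cast; ring

/-- A Leibniz map kills natural number constants. [folklore] -/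
theorem derivation_natCast (m : ℕ) : D (m : R) = 0 := by
  induction m with
  | zero => rw [Nat.cast_zero, derivation_zero D hadd]
  | succ m ih => rw [Nat.cast_succ, hadd, ih, derivation_one D hmul, add_zero]

/-- **A Leibniz map on a polynomial expression**: for `Q = Σ aᵢ Tⁱ` and `y`,
`D(Q(y)) = Σ (D aᵢ) yⁱ + Q'(y) D y`. [folklore] -/
theorem derivation_eval (Q : R[X]) (y : R) :
    D (Q.eval y) = (Q.sum fun i a => D a * y ^ i) + (derivative Q).eval y * D y := by
  induction Q using Polynomial.induction_on' with
  | add p q hp hq =>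
    rw [eval_add, hadd, hp, hq, derivative_add, eval_add, sum_add_index]
    · ring
    · intro i; rw [derivation_zero D hadd, zero_mul]
    · intro i b₁ b₂; rw [hadd, add_mul]
  | monomial m a =>
    rw [eval_monomial, hmul, derivation_pow D hmul, derivative_monomial, eval_monomial,
      sum_monomial_index]
    · ring
    · rw [derivation_zero D hadd, zero_mul]

end Derivation

/-- `∂(Fᵐ)/∂xₗ = m Fᵐ⁻¹ ∂F/∂xₗ`. [folklore] -/
theorem pd_pow (l : Fin n) (F : termFnRing f n) (m : ℕ) :
    pd f n l (F ^ m) = (m : termFnRing f n) * F ^ (m - 1) * pd f n l F :=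
  derivation_pow (pd f n l) (pd_mul f n l) F m

/-- `∂` of a natural number constant vanishes. [folklore] -/
@[simp] theorem pd_natCast (l : Fin n) (m : ℕ) : pd f n l (m : termFnRing f n) = 0 :=
  derivation_natCast (pd f n l) (pd_add f n l) (pd_mul f n l) m

/-- **`∂/∂xₗ` of a polynomial expression**: for `Q = Σ aᵢ Tⁱ` over `k[x̄]ᵉ` and `y ∈ k[x̄]ᵉ`,
`∂(Q(y))/∂xₗ = Σ (∂aᵢ/∂xₗ) yⁱ + Q'(y) ∂y/∂xₗ`. [folklore] -/
theorem pd_eval (l : Fin n) (Q : Polynomial (termFnRing f n)) (y : termFnRing f n) :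
    pd f n l (Q.eval y) =
      (Q.sum fun i a => pd f n l a * y ^ i) + (derivative Q).eval y * pd f n l y :=
  derivation_eval (pd f n l) (pd_add f n l) (pd_mul f n l) Q y

/-- The constant function with value `f c`, `c ∈ k`, as an element of `k[x̄]ᵉ`. [folklore] -/
def constFn (c : k) : termFnRing f n := fnOf f n (var (Sum.inl c))

/-- Values of constants. [folklore] -/
@[simp] theorem coe_constFn (c : k) (x : Fin n → K) : ((constFn f n c : termFnRing f n) : (Fin n → K) → K) x = f c := rfl

/-- Constants have vanishing derivatives. [cite: Wilkie1989, §1, p. 385] -/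
@[simp] theorem pd_constFn (l : Fin n) (c : k) : pd f n l (constFn f n c) = 0 := by
  rw [constFn, pd_fnOf]
  exact Subtype.ext (funext fun x => by simp [termPDeriv])

/-- The coordinate function `xᵢ` as an element of `k[x̄]ᵉ`. [folklore] -/
def coordFn (i : Fin n) : termFnRing f n := fnOf f n (var (Sum.inr i))

/-- Values of coordinates. [folklore] -/
@[simp] theorem coe_coordFn (i : Fin n) (x : Fin n → K) : ((coordFn f n i : termFnRing f n) : (Fin n → K) → K) x = x i := rfl

/-- `∂xᵢ/∂xₗ = δᵢₗ`. [cite: Wilkie1989, §1, p. 385] -/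
theorem pd_coordFn (l i : Fin n) : pd f n l (coordFn f n i) = if i = l then 1 else 0 := by
  rw [coordFn, pd_fnOf]
  apply Subtype.ext; funext x
  by_cases h : i = l
  · subst h; simp [termPDeriv]
  · simp [termPDeriv, h]

/-- The exponential of an element of `k[x̄]ᵉ`. [folklore] -/
def expFn (F : termFnRing f n) : termFnRing f n :=
  ⟨fun x => exp ((F : (Fin n → K) → K) x), Language.orderedExpRing.termExp (reprTerm f n F),
    funext fun x => by simp [realize_reprTerm]⟩

/-- Values of the exponential. [folklore] -/
@[simp] theorem coe_expFn (F : termFnRing f n) (x : Fin n → K) :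
    ((expFn f n F : termFnRing f n) : (Fin n → K) → K) x = exp ((F : (Fin n → K) → K) x) := rfl

/-- `expFn (fnOf t) = fnOf (exp t)`. [folklore] -/
theorem expFn_fnOf (t : Language.orderedExpRing.Term (k ⊕ Fin n)) :
    expFn f n (fnOf f n t) = fnOf f n (Language.orderedExpRing.termExp t) :=
  Subtype.ext (funext fun x => by simp)

/-- The exponential never vanishes. [folklore] -/
theorem expFn_apply_ne_zero (F : termFnRing f n) (x : Fin n → K) :
    ((expFn f n F : termFnRing f n) : (Fin n → K) → K) x ≠ 0 :=
  (exp_pos _).ne'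

/-- Chain rule for the exponential: `∂(e^F)/∂xₗ = e^F ∂F/∂xₗ`. [cite: Wilkie1989, §1, p. 385] -/
@[simp] theorem pd_expFn (l : Fin n) (F : termFnRing f n) : pd f n l (expFn f n F) = expFn f n F * pd f n l F := by
  obtain ⟨t, rfl⟩ := exists_fnOf_eq f n F
  rw [expFn_fnOf, pd_fnOf, pd_fnOf, termPDeriv_termExp]
  exact Subtype.ext (funext fun x => by simp)

/-- Evaluation at a point, a ring homomorphism `k[x̄]ᵉ → K`. [folklore] -/
def evalAt (x : Fin n → K) : termFnRing f n →+* K :=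
  (Pi.evalRingHom (fun _ : Fin n → K => K) x).comp (termFnRing f n).subtype

/-- Unfolding of `evalAt`. [folklore] -/
@[simp] theorem evalAt_apply (x : Fin n → K) (F : termFnRing f n) :
    evalAt f n x F = (F : (Fin n → K) → K) x := rfl

/-! ### Pseudo-division ("by the Euclidean algorithm", p. 393) -/

section PseudoDivision

variable {R : Type*} [CommRing R]

/-- **Pseudo-division** by a polynomial `P` of positive degree `s` with leading coefficient `a`:
for every `Q` there are `m`, `F₁`, `F₂` with `aᵐ Q = F₁ P + F₂` and `deg F₂ < s` (Wilkie 1989,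
p. 393: "by the Euclidean algorithm there exist `F₁, F₂ ∈ Mⱼ₊₁`, `m ∈ ℕ` such that
`aₛᵐ H = F₁ h + F₂` … where `F₂` has degree `< s`"). [cite: Wilkie1989, §3, p. 393] -/
theorem exists_pseudo_division (P : R[X]) (hs : 0 < P.natDegree) (Q : R[X]) :
    ∃ (m : ℕ) (F₁ F₂ : R[X]), C (P.leadingCoeff ^ m) * Q = F₁ * P + F₂ ∧
      F₂.natDegree < P.natDegree := by
  induction hd : Q.natDegree using Nat.strong_induction_on generalizing Q with
  | _ d ih =>
    by_cases hlt : Q.natDegree < P.natDegree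
    · exact ⟨0, 0, Q, by simp, hlt⟩
    · have hle : P.natDegree ≤ d := by rw [← hd]; exact not_lt.1 hlt
      -- cancel the leading term
      set Q₁ : R[X] := C P.leadingCoeff * Q - C Q.leadingCoeff * X ^ (d - P.natDegree) * P with hQ₁
      have hdeg : Q₁.natDegree < d := by
        have hd1 : 1 ≤ d := le_trans (Nat.succ_le_of_lt hs) hle
        suffices h : Q₁.natDegree ≤ d - 1 by omega
        rw [natDegree_le_iff_coeff_eq_zero]
        intro N hN
        have hdN : d ≤ N := by omega
        rw [hQ₁, coeff_sub, coeff_C_mul, mul_assoc, coeff_C_mul, coeff_X_pow_mul',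
          if_pos (by omega : d - P.natDegree ≤ N)]
        rcases hdN.eq_or_lt with rfl | hlt'
        · rw [Nat.sub_sub_self hle]
          have e1 : Q.coeff d = Q.leadingCoeff := by rw [Polynomial.leadingCoeff, hd]
          rw [e1]
          change P.leadingCoeff * Q.leadingCoeff - Q.leadingCoeff * P.leadingCoeff = 0
          ring
        · rw [coeff_eq_zero_of_natDegree_lt (by omega : Q.natDegree < N),
            coeff_eq_zero_of_natDegree_lt (by omega : P.natDegree < N - (d - P.natDegree))]
          ring
      obtain ⟨m, F₁, F₂, hF, hF₂⟩ := ih Q₁.natDegree hdeg Q₁ rfl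
      refine ⟨m + 1, F₁ + C (P.leadingCoeff ^ m * Q.leadingCoeff) * X ^ (d - P.natDegree), F₂, ?_, hF₂⟩
      have e : C (P.leadingCoeff ^ (m + 1)) * Q = C (P.leadingCoeff ^ m) * Q₁ +
          C (P.leadingCoeff ^ m * Q.leadingCoeff) * X ^ (d - P.natDegree) * P := by
        rw [hQ₁]; simp only [C_pow, C_mul]; ring
      rw [e, hF]; simp only [C_pow, C_mul]; ring

end PseudoDivision

/-! ### Admissible chains `k ⊆ k[x₁] ⊆ ⋯ ⊆ k[x̄] ⊆ k[x̄][e^{gₙ}] ⊆ ⋯` and the tower `Mᵢ` (p. 391, p. 395) -/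

section Chain

open scoped Classical

/-- The constants of `k`, a ring homomorphism `k → k[x̄]ᵉ`. [folklore] -/
def constHom : k →+* termFnRing f n where
  toFun := constFn f n
  map_one' := Subtype.ext (funext fun x => by simp)
  map_mul' a b := Subtype.ext (funext fun x => by simp)
  map_zero' := Subtype.ext (funext fun x => by simp)
  map_add' a b := Subtype.ext (funext fun x => by simp)

/-- Values of `constHom`. [folklore] -/
@[simp] theorem constHom_apply (c : k) : constHom f n c = constFn f n c := rfl

/-- The generator adjoined at stage `j` of a chain with exponents `g`: the coordinate `xⱼ₊₁` for
`j < n`, and `e^{gⱼ}` for `j ≥ n` (Wilkie 1989, p. 391; for the subrings "of height `≤ j`" of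
p. 395 the exponents are arbitrary). [cite: Wilkie1989, §3, p. 391] -/
def chainGen (g : ℕ → termFnRing f n) (j : ℕ) : termFnRing f n :=
  if h : j < n then coordFn f n ⟨j, h⟩ else expFn f n (g j)

/-- **The chain of subrings** `M₀ = k ⊆ M₁ = M₀[x₁] ⊆ ⋯ ⊆ Mₙ = k[x₁, …, xₙ] ⊆ Mₙ₊₁ = Mₙ[e^{gₙ}] ⊆ ⋯`
of `k[x̄]ᵉ` with exponents `g` (Wilkie 1989, p. 391; with arbitrary exponents `gⱼ ∈ Mⱼ` these are
the subrings "of height `≤ j - n`" of p. 395). [cite: Wilkie1989, §3, p. 391] -/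
def chain (g : ℕ → termFnRing f n) : ℕ → Subring (termFnRing f n)
  | 0 => (constHom f n).range
  | j + 1 => (Polynomial.eval₂RingHom (chain g j).subtype (chainGen f n g j)).range

variable (g : ℕ → termFnRing f n)

/-- Membership in `M₀`: the constants. [cite: Wilkie1989, §3, p. 391] -/
theorem mem_chain_zero {F : termFnRing f n} : F ∈ chain f n g 0 ↔ ∃ c : k, constFn f n c = F := by
  show F ∈ (constHom f n).range ↔ _
  simp [RingHom.mem_range]

/-- Membership in `Mⱼ₊₁ = Mⱼ[Yⱼ]`: polynomial expressions in the generator with coefficients in `Mⱼ`.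
[cite: Wilkie1989, §3, p. 391] -/
theorem mem_chain_succ {j : ℕ} {F : termFnRing f n} :
    F ∈ chain f n g (j + 1) ↔ ∃ P : Polynomial (chain f n g j),
      (P.map (chain f n g j).subtype).eval (chainGen f n g j) = F := by
  show F ∈ (Polynomial.eval₂RingHom (chain f n g j).subtype (chainGen f n g j)).range ↔ _
  simp [RingHom.mem_range, eval₂_eq_eval_map]

/-- `Mⱼ ⊆ Mⱼ₊₁`. [cite: Wilkie1989, §3, p. 391] -/
theorem chain_le_succ (j : ℕ) : chain f n g j ≤ chain f n g (j + 1) := by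
  intro F hF
  rw [mem_chain_succ]
  exact ⟨Polynomial.C ⟨F, hF⟩, by simp⟩

/-- The chain is increasing. [cite: Wilkie1989, §3, p. 391] -/
theorem chain_mono : Monotone (chain f n g) :=
  monotone_nat_of_le_succ (chain_le_succ f n g)

/-- The generator `Yⱼ` lies in `Mⱼ₊₁`. [cite: Wilkie1989, §3, p. 391] -/
theorem chainGen_mem (j : ℕ) : chainGen f n g j ∈ chain f n g (j + 1) := by
  rw [mem_chain_succ]
  exact ⟨Polynomial.X, by simp⟩

/-- The coordinate function `xᵢ₊₁` lies in `Mᵢ₊₁`. [cite: Wilkie1989, §3, p. 391] -/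
theorem coordFn_mem_chain (i : Fin n) : coordFn f n i ∈ chain f n g (i + 1) := by
  have := chainGen_mem f n g i
  rwa [chainGen, dif_pos i.isLt] at this

/-- Constants lie in every `Mⱼ`. [folklore] -/
theorem constFn_mem_chain (c : k) (j : ℕ) : constFn f n c ∈ chain f n g j :=
  chain_mono f n g (Nat.zero_le j) (mem_chain_zero f n g |>.2 ⟨c, rfl⟩)

/-- For `j ≥ n` the generator is `e^{gⱼ}`. [cite: Wilkie1989, §3, p. 391] -/
theorem chainGen_of_le {j : ℕ} (hj : n ≤ j) : chainGen f n g j = expFn f n (g j) := by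
  rw [chainGen, dif_neg (not_lt.2 hj)]

/-- For `j < n` the generator is `xⱼ₊₁`. [cite: Wilkie1989, §3, p. 391] -/
theorem chainGen_of_lt {j : ℕ} (hj : j < n) : chainGen f n g j = coordFn f n ⟨j, hj⟩ := by
  rw [chainGen, dif_pos hj]

/-- **`Mⱼ = k[x₁, …, xⱼ]` for `j ≤ n`: its elements depend only on the first `j` coordinates.**
[cite: Wilkie1989, §3, p. 391] -/
theorem apply_eq_of_mem_chain {j : ℕ} (hj : j ≤ n) {F : termFnRing f n} (hF : F ∈ chain f n g j)
    (x y : Fin n → K) (hxy : ∀ i : Fin n, i.val < j → x i = y i) :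
    (F : (Fin n → K) → K) x = (F : (Fin n → K) → K) y := by
  induction j generalizing F with
  | zero =>
    obtain ⟨c, rfl⟩ := (mem_chain_zero f n g).1 hF
    rfl
  | succ j ih =>
    obtain ⟨P, rfl⟩ := (mem_chain_succ f n g).1 hF
    have hjn : j < n := Nat.lt_of_succ_le hj
    rw [chainGen_of_lt f n g hjn]
    have ex : ∀ z : Fin n → K, ((((P.map (chain f n g j).subtype).eval (coordFn f n ⟨j, hjn⟩) :
        termFnRing f n) : (Fin n → K) → K) z) =
        ∑ e ∈ (P.map (chain f n g j).subtype).support,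
          (((P.map (chain f n g j).subtype).coeff e : termFnRing f n) : (Fin n → K) → K) z *
            z ⟨j, hjn⟩ ^ e := by
      intro z
      rw [eval_eq_sum, Polynomial.sum_def]
      push_cast
      rw [Finset.sum_apply]
      refine Finset.sum_congr rfl fun e _ => ?_
      simp only [Pi.mul_apply, Pi.pow_apply, coe_coordFn]
    rw [ex, ex]
    refine Finset.sum_congr rfl fun e _ => ?_
    rw [hxy ⟨j, hjn⟩ (Nat.lt_succ_self j)]
    congr 1
    have hmem : ((P.map (chain f n g j).subtype).coeff e : termFnRing f n) ∈ chain f n g j := by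
      rw [coeff_map]; exact (P.coeff e).2
    exact ih (Nat.le_of_succ_le hj) hmem fun i hi => hxy i (Nat.lt_succ_of_lt hi)

/-- **`∂F/∂xₗ = 0` for `F ∈ Mⱼ = k[x₁, …, xⱼ]` and `l > j`** (Wilkie 1989, p. 392: "`∂f/∂xᵢ = 0` for
all `f ∈ Mⱼ` and `i > j`"). [cite: Wilkie1989, §3, p. 392] -/
theorem pd_eq_zero_of_mem_chain {j : ℕ} (hj : j ≤ n) {F : termFnRing f n} (hF : F ∈ chain f n g j)
    (l : Fin n) (hl : j ≤ l.val) : pd f n l F = 0 := by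
  induction j generalizing F with
  | zero =>
    obtain ⟨c, rfl⟩ := (mem_chain_zero f n g).1 hF
    exact pd_constFn f n l c
  | succ j ih =>
    obtain ⟨P, rfl⟩ := (mem_chain_succ f n g).1 hF
    have hjn : j < n := Nat.lt_of_succ_le hj
    rw [pd_eval]
    have h1 : ((P.map (chain f n g j).subtype).sum fun i a => pd f n l a * chainGen f n g j ^ i)
        = 0 := by
      refine Finset.sum_eq_zero fun i _ => ?_
      have hmem : ((P.map (chain f n g j).subtype).coeff i : termFnRing f n) ∈ chain f n g j := by
        rw [coeff_map]; exact (P.coeff i).2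
      have h0 := ih (Nat.le_of_succ_le hj) hmem (le_trans (Nat.le_succ j) hl)
      dsimp only
      rw [h0, zero_mul]
    have h2 : pd f n l (chainGen f n g j) = 0 := by
      rw [chainGen_of_lt f n g hjn, pd_coordFn]
      have : (⟨j, hjn⟩ : Fin n) ≠ l := fun h => by
        have := congrArg Fin.val h; simp at this; omega
      rw [if_neg this]
    rw [h1, h2, mul_zero, add_zero]

/-- **Each `Mⱼ` is closed under partial differentiation** provided the exponents satisfy `gⱼ ∈ Mⱼ`
(Wilkie 1989, p. 391: "each `Mᵢ` … is closed under partial differentiation"). [cite: Wilkie1989, §3, p. 391] -/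
theorem pd_mem_chain (hg : ∀ i, n ≤ i → g i ∈ chain f n g i) {j : ℕ} {F : termFnRing f n}
    (hF : F ∈ chain f n g j) (l : Fin n) : pd f n l F ∈ chain f n g j := by
  induction j generalizing F with
  | zero =>
    obtain ⟨c, rfl⟩ := (mem_chain_zero f n g).1 hF
    rw [pd_constFn]
    exact Subring.zero_mem _
  | succ j ih =>
    obtain ⟨P, rfl⟩ := (mem_chain_succ f n g).1 hF
    rw [pd_eval]
    refine Subring.add_mem _ (Subring.sum_mem _ fun i _ => Subring.mul_mem _ ?_ ?_)
      (Subring.mul_mem _ ?_ ?_)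
    · have hmem : ((P.map (chain f n g j).subtype).coeff i : termFnRing f n) ∈ chain f n g j := by
        rw [coeff_map]; exact (P.coeff i).2
      exact chain_le_succ f n g j (ih hmem)
    · exact Subring.pow_mem _ (chainGen_mem f n g j) _
    · rw [derivative_map, mem_chain_succ]
      exact ⟨derivative P, rfl⟩
    · by_cases hjn : j < n
      · rw [chainGen_of_lt f n g hjn, pd_coordFn]
        split_ifs
        · exact Subring.one_mem _
        · exact Subring.zero_mem _
      · rw [chainGen_of_le f n g (not_lt.1 hjn), pd_expFn]
        refine Subring.mul_mem _ ?_ (chain_le_succ f n g j (ih (hg j (not_lt.1 hjn))))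
        have := chainGen_mem f n g j
        rwa [chainGen_of_le f n g (not_lt.1 hjn)] at this

end Chain

/-! ### The tower `M₀ ⊆ M₁ ⊆ ⋯` exhausting `k[x̄]ᵉ` (Wilkie 1989, p. 391) -/

section Tower

open scoped Classical

variable [Countable k]

/-- An enumeration of the (countably many) terms with parameters from the countable `k`
(Wilkie 1989, p. 391: "Let us suppose that `k` is countable … Clearly this is possible").
[cite: Wilkie1989, §3, p. 391] -/
def enumTerm : ℕ → Language.orderedExpRing.Term (k ⊕ Fin n) :=
  Classical.choose (exists_surjective_nat (Language.orderedExpRing.Term (k ⊕ Fin n)))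

/-- The enumeration of terms is surjective. [folklore] -/
theorem enumTerm_surjective :
    Function.Surjective (enumTerm n : ℕ → Language.orderedExpRing.Term (k ⊕ Fin n)) :=
  Classical.choose_spec (exists_surjective_nat (Language.orderedExpRing.Term (k ⊕ Fin n)))

/-- The index `m` is a candidate at the subring `M`: the `m`-th term defines a function in `M` whose
exponential is not yet in `M`. [folklore] -/
def IsCand (M : Subring (termFnRing f n)) (m : ℕ) : Prop :=
  fnOf f n (enumTerm n m) ∈ M ∧ expFn f n (fnOf f n (enumTerm n m)) ∉ M

/-- The exponent `g` chosen at `M` (Wilkie's `gᵢ ∈ Mᵢ`): the function of the least-index candidate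
term, or `0` if there is none. [cite: Wilkie1989, §3, p. 391] -/
def sel (M : Subring (termFnRing f n)) : termFnRing f n :=
  if h : ∃ m, IsCand f n M m then fnOf f n (enumTerm n (Nat.find h)) else 0

/-- The chosen exponent lies in `M`. [cite: Wilkie1989, §3, p. 391] -/
theorem sel_mem (M : Subring (termFnRing f n)) : sel f n M ∈ M := by
  unfold sel
  split_ifs with h
  · exact (Nat.find_spec h).1
  · exact M.zero_mem

/-- The generator adjoined to `M` at stage `j` of the tower: `xⱼ₊₁` for `j < n`, `e^{sel M}` for
`j ≥ n`. [cite: Wilkie1989, §3, p. 391] -/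
def towerGen (j : ℕ) (M : Subring (termFnRing f n)) : termFnRing f n :=
  if h : j < n then coordFn f n ⟨j, h⟩ else expFn f n (sel f n M)

/-- **The tower** `M₀ = k ⊆ M₁ ⊆ ⋯` of Wilkie 1989, p. 391, with the least-index choice of the
exponents `gᵢ ∈ Mᵢ`. [cite: Wilkie1989, §3, p. 391] -/
def tower : ℕ → Subring (termFnRing f n)
  | 0 => (constHom f n).range
  | j + 1 => (Polynomial.eval₂RingHom (tower j).subtype (towerGen f n j (tower j))).range

/-- The exponents of the tower: `gⱼ = sel Mⱼ`. [cite: Wilkie1989, §3, p. 391] -/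
def towerExp : ℕ → termFnRing f n := fun j => sel f n (tower f n j)

/-- **The tower is the chain with exponents `towerExp`.** [folklore] -/
theorem tower_eq_chain : ∀ j, tower f n j = chain f n (towerExp f n) j
  | 0 => rfl
  | j + 1 => by
    show (Polynomial.eval₂RingHom (tower f n j).subtype (towerGen f n j (tower f n j))).range =
      (Polynomial.eval₂RingHom (chain f n (towerExp f n) j).subtype (chainGen f n (towerExp f n) j)).range
    have hgen : towerGen f n j (tower f n j) = chainGen f n (towerExp f n) j := rfl
    rw [hgen, tower_eq_chain j]

/-- The exponents lie in the chain: `gⱼ ∈ Mⱼ`. [cite: Wilkie1989, §3, p. 391] -/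
theorem towerExp_mem (j : ℕ) : towerExp f n j ∈ chain f n (towerExp f n) j := by
  rw [← tower_eq_chain]
  exact sel_mem f n _

/-- The tower is increasing. [cite: Wilkie1989, §3, p. 391] -/
theorem tower_mono : Monotone (tower f n) := by
  have : tower f n = chain f n (towerExp f n) := funext (tower_eq_chain f n)
  rw [this]
  exact chain_mono f n _

/-- **The tower exhausts `k[x̄]ᵉ`** (Wilkie 1989, p. 391: "`gᵢ ∈ Mᵢ` is chosen in some way so that
`k[x̄]ᵉ = ⋃ᵢ Mᵢ`. Clearly this is possible"): with the least-index choice of the `gᵢ`, every term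
function lies in some `Mⱼ`. [cite: Wilkie1989, §3, p. 391] -/
theorem exists_mem_tower (t : Language.orderedExpRing.Term (k ⊕ Fin n)) :
    ∃ j, fnOf f n t ∈ tower f n j := by
  simp only [tower_eq_chain]
  induction t with
  | var x =>
    rcases x with c | i
    · exact ⟨0, (mem_chain_zero f n _).2 ⟨c, rfl⟩⟩
    · exact ⟨i + 1, coordFn_mem_chain f n _ i⟩
  | func g ts ih =>
    cases g with
    | add =>
      obtain ⟨j₀, h₀⟩ := ih 0
      obtain ⟨j₁, h₁⟩ := ih 1
      refine ⟨max j₀ j₁, ?_⟩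
      have e : fnOf f n (func expRingFunc.add ts) = fnOf f n (ts 0) + fnOf f n (ts 1) :=
        Subtype.ext (funext fun x => by simp [Term.realize])
      rw [e]
      exact Subring.add_mem _ (chain_mono f n _ (le_max_left _ _) h₀)
        (chain_mono f n _ (le_max_right _ _) h₁)
    | mul =>
      obtain ⟨j₀, h₀⟩ := ih 0
      obtain ⟨j₁, h₁⟩ := ih 1
      refine ⟨max j₀ j₁, ?_⟩
      have e : fnOf f n (func expRingFunc.mul ts) = fnOf f n (ts 0) * fnOf f n (ts 1) :=
        Subtype.ext (funext fun x => by simp [Term.realize])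
      rw [e]
      exact Subring.mul_mem _ (chain_mono f n _ (le_max_left _ _) h₀)
        (chain_mono f n _ (le_max_right _ _) h₁)
    | neg =>
      obtain ⟨j₀, h₀⟩ := ih 0
      refine ⟨j₀, ?_⟩
      have e : fnOf f n (func expRingFunc.neg ts) = -fnOf f n (ts 0) :=
        Subtype.ext (funext fun x => by simp [Term.realize])
      rw [e]
      exact Subring.neg_mem _ h₀
    | zero =>
      refine ⟨0, ?_⟩
      have e : fnOf f n (func expRingFunc.zero ts) = 0 :=
        Subtype.ext (funext fun x => by simp [Term.realize])
      rw [e]; exact Subring.zero_mem _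
    | one =>
      refine ⟨0, ?_⟩
      have e : fnOf f n (func expRingFunc.one ts) = 1 :=
        Subtype.ext (funext fun x => by simp [Term.realize])
      rw [e]; exact Subring.one_mem _
    | exp =>
      obtain ⟨j₀, h₀⟩ := ih 0
      have e : fnOf f n (func expRingFunc.exp ts) = expFn f n (fnOf f n (ts 0)) :=
        Subtype.ext (funext fun x => by simp [Term.realize])
      rw [e]
      by_contra hnot
      push Not at hnot
      -- an index of the term `ts 0`
      obtain ⟨m₀, hm₀⟩ := enumTerm_surjective n (ts 0)
      set j₁ := max j₀ n with hj₁
      -- at every stage `j ≥ j₁` the index `m₀` is a candidate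
      have hcand : ∀ j, j₁ ≤ j → IsCand f n (tower f n j) m₀ := by
        intro j hj
        rw [tower_eq_chain]
        refine ⟨?_, ?_⟩
        · rw [hm₀]; exact chain_mono f n _ (le_trans (le_max_left _ _) hj) h₀
        · rw [hm₀]; exact hnot j
      have hex : ∀ j, j₁ ≤ j → ∃ m, IsCand f n (tower f n j) m := fun j hj => ⟨m₀, hcand j hj⟩
      -- the selected index at stage `j ≥ j₁`
      let μ : ℕ → ℕ := fun j => if h : ∃ m, IsCand f n (tower f n j) m then Nat.find h else 0
      have hμle : ∀ j, j₁ ≤ j → μ j ≤ m₀ := by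
        intro j hj
        simp only [μ, dif_pos (hex j hj)]
        exact Nat.find_min' _ (hcand j hj)
      have hμspec : ∀ j, j₁ ≤ j → IsCand f n (tower f n j) (μ j) := by
        intro j hj
        simp only [μ, dif_pos (hex j hj)]
        exact Nat.find_spec (hex j hj)
      -- the exponential of the selected term enters the tower at the next stage
      have hnext : ∀ j, j₁ ≤ j → expFn f n (fnOf f n (enumTerm n (μ j))) ∈
          chain f n (towerExp f n) (j + 1) := by
        intro j hj
        have hnj : n ≤ j := le_trans (le_max_right _ _) hj
        have hgen := chainGen_mem f n (towerExp f n) j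
        rw [chainGen_of_le f n _ hnj, towerExp, sel, dif_pos (hex j hj)] at hgen
        simp only [μ, dif_pos (hex j hj)]
        exact hgen
      -- hence the selected indices at distinct stages `≥ j₁` are distinct
      have hinj : ∀ j j', j₁ ≤ j → j < j' → μ j ≠ μ j' := by
        intro j j' hj hjj' heq
        have h1 := hnext j hj
        have h2 := (hμspec j' (le_trans hj hjj'.le)).2
        rw [← heq, tower_eq_chain] at h2
        exact h2 (chain_mono f n _ (Nat.succ_le_of_lt hjj') h1)
      -- pigeonhole
      obtain ⟨a, b, hab, heq⟩ := Fintype.exists_ne_map_eq_of_card_lt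
        (fun i : Fin (m₀ + 2) => (⟨μ (j₁ + i), Nat.lt_succ_of_le (hμle _ (Nat.le_add_right _ _))⟩ :
          Fin (m₀ + 1))) (by simp)
      have heq' : μ (j₁ + a) = μ (j₁ + b) := congrArg Fin.val heq
      rcases lt_or_gt_of_ne hab with h | h
      · exact hinj _ _ (Nat.le_add_right _ _) (Nat.add_lt_add_left h j₁) heq'
      · exact hinj _ _ (Nat.le_add_right _ _) (Nat.add_lt_add_left h j₁) heq'.symm

/-- Every term function lies in some member of the chain with exponents `towerExp`. [cite: Wilkie1989, §3, p. 391] -/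
theorem exists_mem_chain_towerExp (t : Language.orderedExpRing.Term (k ⊕ Fin n)) :
    ∃ j, fnOf f n t ∈ chain f n (towerExp f n) j := by
  simpa only [tower_eq_chain] using exists_mem_tower f n t

end Tower

/-! ### Systems of term functions: zero sets, gradient rows, local vanishing -/

section Systems

variable {p : ℕ}

/-- The zero set of a system of term functions. [cite: Wilkie1989, §3, p. 390] -/
def VF (F : Fin p → termFnRing f n) : Set (Fin n → K) :=
  {x | ∀ r, ((F r : termFnRing f n) : (Fin n → K) → K) x = 0}

/-- The gradient row `(∂F/∂x₁, …, ∂F/∂xₙ)(x)` of a term function. [cite: Wilkie1989, §1, p. 385] -/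
def jrow (F : termFnRing f n) (x : Fin n → K) : Fin n → K :=
  fun l => ((pd f n l F : termFnRing f n) : (Fin n → K) → K) x

/-- The non-singular zero set of a system of term functions. [cite: Wilkie1989, §3, p. 390] -/
def VnsF (F : Fin p → termFnRing f n) : Set (Fin n → K) :=
  {x | x ∈ VF f n F ∧ LinearIndependent K (fun r => jrow f n (F r) x)}

/-- "`G` vanishes on `V(F)` close to `β`" for term functions. [cite: Wilkie1989, §3, p. 391] -/
def VCT (G : termFnRing f n) (F : Fin p → termFnRing f n) (β : Fin n → K) : Prop :=
  ∃ ε : K, 0 < ε ∧ ∀ x : Fin n → K, ∑ j, (x j - β j) ^ 2 < ε → x ∈ VF f n F →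
    ((G : termFnRing f n) : (Fin n → K) → K) x = 0

variable {f n}

/-- Membership in the zero set. [folklore] -/
@[simp] theorem mem_VF {F : Fin p → termFnRing f n} {x : Fin n → K} :
    x ∈ VF f n F ↔ ∀ r, ((F r : termFnRing f n) : (Fin n → K) → K) x = 0 := Iff.rfl

/-- The gradient row of the function of a term is the gradient row of the term. [folklore] -/
theorem jrow_eq_grad {F : termFnRing f n} {t : Language.orderedExpRing.Term (k ⊕ Fin n)}
    (ht : fnOf f n t = F) (x : Fin n → K) : jrow f n F x = grad t f x := by
  funext l
  rw [jrow, coe_pd_of_eq f n l ht x, grad_apply]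

/-- The zero set of the functions of terms is the zero set of the terms. [folklore] -/
theorem VF_eq_zeroSet {F : Fin p → termFnRing f n} {t : Fin p → Language.orderedExpRing.Term (k ⊕ Fin n)}
    (ht : ∀ r, fnOf f n (t r) = F r) : VF f n F = zeroSet t f := by
  ext x
  simp only [mem_VF, mem_zeroSet]
  refine forall_congr' fun r => ?_
  rw [← ht r]
  rfl

/-- The non-singular zero set of the functions of terms is that of the terms. [folklore] -/
theorem VnsF_eq_nonsingularZeroSet {F : Fin p → termFnRing f n}
    {t : Fin p → Language.orderedExpRing.Term (k ⊕ Fin n)} (ht : ∀ r, fnOf f n (t r) = F r) :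
    VnsF f n F = nonsingularZeroSet t f := by
  ext x
  rw [VnsF, Set.mem_setOf_eq, mem_nonsingularZeroSet, VF_eq_zeroSet ht]
  simp only [jrow_eq_grad (ht _)]

/-- Local vanishing of the function of a term is local vanishing of the term. [folklore] -/
theorem vct_iff_vanishesCloseTo {F : Fin p → termFnRing f n}
    {t : Fin p → Language.orderedExpRing.Term (k ⊕ Fin n)} (ht : ∀ r, fnOf f n (t r) = F r)
    (g : Language.orderedExpRing.Term (k ⊕ Fin n)) (β : Fin n → K) :
    VCT f n (fnOf f n g) F β ↔ VanishesCloseTo g t f β := by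
  simp only [VCT, VanishesCloseTo, VF_eq_zeroSet ht]
  rfl

/-- The system extended by one function has the expected zero set. [folklore] -/
theorem mem_VF_snoc {F : Fin p → termFnRing f n} {G : termFnRing f n} {x : Fin n → K} :
    x ∈ VF f n (Fin.snoc F G) ↔ x ∈ VF f n F ∧ ((G : termFnRing f n) : (Fin n → K) → K) x = 0 := by
  simp only [mem_VF]
  constructor
  · intro h
    exact ⟨fun r => by simpa using h (Fin.castSucc r), by simpa using h (Fin.last p)⟩
  · rintro ⟨h1, h2⟩ r
    refine Fin.lastCases ?_ (fun r => ?_) r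
    · simpa using h2
    · simpa using h1 r

/-- Gradient rows of the extended system. [folklore] -/
theorem jrow_snoc (F : Fin p → termFnRing f n) (G : termFnRing f n) (x : Fin n → K) :
    (fun r => jrow f n ((Fin.snoc F G : Fin (p + 1) → termFnRing f n) r) x) =
      Fin.snoc (fun r => jrow f n (F r) x) (jrow f n G x) := by
  funext r
  refine Fin.lastCases ?_ (fun r => ?_) r <;> simp

/-- Local vanishing of finitely many functions at once. [folklore] -/
theorem vct_finset {ι : Type*} (s : Finset ι) {G : ι → termFnRing f n} {F : Fin p → termFnRing f n}
    {β : Fin n → K} (h : ∀ i ∈ s, VCT f n (G i) F β) :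
    ∃ ε : K, 0 < ε ∧ ∀ i ∈ s, ∀ x : Fin n → K, ∑ j, (x j - β j) ^ 2 < ε → x ∈ VF f n F →
      ((G i : termFnRing f n) : (Fin n → K) → K) x = 0 := by
  classical
  induction s using Finset.induction_on with
  | empty => exact ⟨1, one_pos, fun i hi => (Finset.notMem_empty i hi).elim⟩
  | insert a s ha ih =>
    obtain ⟨ε₁, hε₁, h₁⟩ := ih fun i hi => h i (Finset.mem_insert_of_mem hi)
    obtain ⟨ε₂, hε₂, h₂⟩ := h a (Finset.mem_insert_self a s)
    refine ⟨min ε₁ ε₂, lt_min hε₁ hε₂, fun i hi x hx hV => ?_⟩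
    rcases Finset.mem_insert.1 hi with rfl | hi
    · exact h₂ x (lt_of_lt_of_le hx (min_le_right _ _)) hV
    · exact h₁ i hi x (lt_of_lt_of_le hx (min_le_left _ _)) hV

/-- `VCT` is monotone in the radius data: shrinking is allowed. [folklore] -/
theorem VCT.of_subset {G : termFnRing f n} {F : Fin p → termFnRing f n} {β : Fin n → K}
    {q : ℕ} {F' : Fin q → termFnRing f n} (hFF' : VF f n F' ⊆ VF f n F) (h : VCT f n G F β) :
    VCT f n G F' β := by
  obtain ⟨ε, hε, H⟩ := h
  exact ⟨ε, hε, fun x hx hV => H x hx (hFF' hV)⟩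

/-! ### The calculus facts, for term functions -/

/-- **§2 for term functions** (from `vanishesCloseTo_of_wedge_vanishes`). [cite: Wilkie1989, §2, p. 390] -/
theorem vct_of_wedge {F : Fin p → termFnRing f n} {T A0 : termFnRing f n} {β : Fin n → K}
    (hβ : β ∈ VF f n F) (hind : LinearIndependent K (fun r => jrow f n (F r) β))
    (hA0 : ((A0 : termFnRing f n) : (Fin n → K) → K) β ≠ 0)
    (hT : ((T : termFnRing f n) : (Fin n → K) → K) β = 0) {ε : K} (hε : 0 < ε)
    (hdep : ∀ x : Fin n → K, ∑ j, (x j - β j) ^ 2 < ε → x ∈ VF f n F →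
      (((A0 : termFnRing f n) : (Fin n → K) → K) x • jrow f n T x -
          ((T : termFnRing f n) : (Fin n → K) → K) x • jrow f n A0 x) ∈
        Submodule.span K (Set.range fun r => jrow f n (F r) x)) :
    VCT f n T F β := by
  set t : Fin p → Language.orderedExpRing.Term (k ⊕ Fin n) := fun r => reprTerm f n (F r) with htdef
  have ht : ∀ r, fnOf f n (t r) = F r := fun r => Subtype.ext (termFn_reprTerm f n (F r))
  obtain ⟨tT, rfl⟩ := exists_fnOf_eq f n T
  obtain ⟨tA, rfl⟩ := exists_fnOf_eq f n A0
  have hV := VF_eq_zeroSet ht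
  have key := vanishesCloseTo_of_wedge_vanishes K f t tT tA β (by rwa [← hV])
    (by simpa only [jrow_eq_grad (ht _)] using hind) hA0 hT hε
    (fun x hx hVx => by
      have := hdep x hx (by rwa [hV])
      rw [← jrow_eq_grad (rfl : fnOf f n tT = fnOf f n tT),
        ← jrow_eq_grad (rfl : fnOf f n tA = fnOf f n tA)]
      simpa only [jrow_eq_grad (ht _), coe_fnOf, termFn_apply] using this)
  rw [vct_iff_vanishesCloseTo ht]
  exact key

/-- **Converse of §2 at the point, for term functions** (from
`not_linearIndependent_of_vanishesCloseTo`): if `T` vanishes on `V(F)` close to `β ∈ V(F)` then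
`∇T(β)` lies in the span of the independent rows `∇Fᵣ(β)` — i.e. the rows of the extended system
are dependent. [cite: Wilkie1989, §2, p. 390] -/
theorem not_linearIndependent_snoc_of_vct {F : Fin p → termFnRing f n} {T : termFnRing f n}
    {β : Fin n → K} (hβ : β ∈ VF f n F) (hT : VCT f n T F β) :
    ¬ LinearIndependent K (Fin.snoc (fun r => jrow f n (F r) β) (jrow f n T β) :
      Fin (p + 1) → Fin n → K) := by
  set t : Fin p → Language.orderedExpRing.Term (k ⊕ Fin n) := fun r => reprTerm f n (F r) with htdef
  have ht : ∀ r, fnOf f n (t r) = F r := fun r => Subtype.ext (termFn_reprTerm f n (F r))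
  obtain ⟨tT, htT⟩ := exists_fnOf_eq f n T
  have hV := VF_eq_zeroSet ht
  have key := not_linearIndependent_of_vanishesCloseTo K f t tT β (by rwa [← hV])
    (by rw [← htT, vct_iff_vanishesCloseTo ht] at hT; exact hT)
  intro hli
  apply key
  rw [linearIndependent_finSnoc] at hli
  rw [linearIndependent_option]
  refine ⟨?_, ?_⟩
  · show LinearIndependent K (fun r => gradRows t tT f β (some r))
    simpa only [gradRows_some, ← jrow_eq_grad (ht _)] using hli.1
  · show gradRows t tT f β none ∉ Submodule.span K (Set.range fun r => gradRows t tT f β (some r))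
    simpa only [gradRows_none, gradRows_some, ← jrow_eq_grad (ht _), ← jrow_eq_grad htT] using hli.2

/-- **Continuity for term functions** (from `exists_ball_ne_zero`). [cite: Wilkie1989, §3, p. 393] -/
theorem exists_ball_ne_zero' (G : termFnRing f n) (β : Fin n → K)
    (hG : ((G : termFnRing f n) : (Fin n → K) → K) β ≠ 0) :
    ∃ ε : K, 0 < ε ∧ ∀ x : Fin n → K, ∑ j, (x j - β j) ^ 2 < ε →
      ((G : termFnRing f n) : (Fin n → K) → K) x ≠ 0 := by
  obtain ⟨t, rfl⟩ := exists_fnOf_eq f n G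
  exact exists_ball_ne_zero K f t β hG

end Systems

/-! ### Degrees in `Mⱼ₊₁ = Mⱼ[Yⱼ]` -/

section Degrees

variable {f n}
variable (M : Subring (termFnRing f n)) (Y : termFnRing f n)

/-- `G ∈ M[Y]` has **degree `< s`**: it is a polynomial expression in `Y` of degree `< s` with
coefficients in `M` (Wilkie 1989, p. 395: "an element `h` of `M` has degree `≤ s` (in `M`) if
`h = Σᵢ₌₀ˢ aᵢ e^{ig}` for some `a₀, …, aₛ ∈ M'`"). [cite: Wilkie1989, §3, p. 395] -/
def DegLT (G : termFnRing f n) (s : ℕ) : Prop :=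
  ∃ P : Polynomial M, P.natDegree < s ∧ (P.map M.subtype).eval Y = G

variable {M Y}

/-- A polynomial of degree `< s` defines an element of degree `< s`. [folklore] -/
theorem degLT_eval {P : Polynomial M} {s : ℕ} (hP : P.natDegree < s) :
    DegLT M Y ((P.map M.subtype).eval Y) s := ⟨P, hP, rfl⟩

/-- Elements of `M` have degree `< s` for every `s ≥ 1`. [folklore] -/
theorem degLT_of_mem {G : termFnRing f n} (hG : G ∈ M) {s : ℕ} (hs : 0 < s) : DegLT M Y G s :=
  ⟨Polynomial.C ⟨G, hG⟩, by simpa using hs, by simp⟩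

/-- Degree `< s` is closed under addition. [folklore] -/
theorem DegLT.add {G₁ G₂ : termFnRing f n} {s : ℕ} (h₁ : DegLT M Y G₁ s) (h₂ : DegLT M Y G₂ s) :
    DegLT M Y (G₁ + G₂) s := by
  obtain ⟨P₁, hP₁, rfl⟩ := h₁
  obtain ⟨P₂, hP₂, rfl⟩ := h₂
  refine ⟨P₁ + P₂, lt_of_le_of_lt (natDegree_add_le _ _) (max_lt hP₁ hP₂), ?_⟩
  simp [Polynomial.map_add]

/-- Degree `< s` is closed under negation. [folklore] -/
theorem DegLT.neg {G : termFnRing f n} {s : ℕ} (h : DegLT M Y G s) : DegLT M Y (-G) s := by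
  obtain ⟨P, hP, rfl⟩ := h
  refine ⟨-P, by rwa [natDegree_neg], ?_⟩
  simp [Polynomial.map_neg]

/-- Degree `< s` is closed under subtraction. [folklore] -/
theorem DegLT.sub {G₁ G₂ : termFnRing f n} {s : ℕ} (h₁ : DegLT M Y G₁ s) (h₂ : DegLT M Y G₂ s) :
    DegLT M Y (G₁ - G₂) s := by
  rw [sub_eq_add_neg]; exact h₁.add h₂.neg

/-- Degree `< s` is closed under multiplication by elements of `M`. [folklore] -/
theorem DegLT.mul_mem {G m : termFnRing f n} {s : ℕ} (h : DegLT M Y G s) (hm : m ∈ M) :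
    DegLT M Y (G * m) s := by
  obtain ⟨P, hP, rfl⟩ := h
  refine ⟨P * Polynomial.C ⟨m, hm⟩, lt_of_le_of_lt (natDegree_mul_C_le _ _) hP, ?_⟩
  simp [Polynomial.map_mul]

/-- `0` has degree `< s` (`s ≥ 1`). [folklore] -/
theorem degLT_zero {s : ℕ} (hs : 0 < s) : DegLT M Y (0 : termFnRing f n) s :=
  ⟨0, by simpa using hs, by simp⟩

/-- Degree `< s` (`s ≥ 1`) is closed under finite sums. [folklore] -/
theorem DegLT.sum {ι : Type*} (S : Finset ι) {G : ι → termFnRing f n} {s : ℕ} (hs : 0 < s)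
    (h : ∀ i ∈ S, DegLT M Y (G i) s) : DegLT M Y (∑ i ∈ S, G i) s := by
  classical
  induction S using Finset.induction_on with
  | empty => simpa using degLT_zero (M := M) (Y := Y) hs
  | insert a S ha ih =>
    rw [Finset.sum_insert ha]
    exact (h a (Finset.mem_insert_self a S)).add (ih fun i hi => h i (Finset.mem_insert_of_mem hi))

/-- **Values of a polynomial expression**: `(Σ aₑ Yᵉ)(x) = Σₑ aₑ(x) Y(x)ᵉ`. [folklore] -/
theorem coe_eval_apply (P : Polynomial M) (Y : termFnRing f n) (x : Fin n → K) :
    ((((P.map M.subtype).eval Y : termFnRing f n)) : (Fin n → K) → K) x =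
      ∑ e ∈ Finset.range (P.natDegree + 1),
        (((P.coeff e : M) : termFnRing f n) : (Fin n → K) → K) x *
          (((Y : termFnRing f n) : (Fin n → K) → K) x) ^ e := by
  rw [eval_eq_sum_range' (lt_of_le_of_lt (natDegree_map_le) (Nat.lt_succ_self _))]
  push_cast
  rw [Finset.sum_apply]
  refine Finset.sum_congr rfl fun e _ => ?_
  rw [Pi.mul_apply, Pi.pow_apply, coeff_map]
  rfl

/-- The polynomial over `K` obtained by evaluating the coefficients at a point. [folklore] -/
def polyAt (P : Polynomial M) (x : Fin n → K) : Polynomial K :=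
  P.map ((evalAt f n x).comp M.subtype)

/-- Evaluation of `polyAt`. [folklore] -/
theorem eval_polyAt (P : Polynomial M) (x : Fin n → K) (y : K) :
    (polyAt P x).eval y = ∑ e ∈ Finset.range (P.natDegree + 1),
      (((P.coeff e : M) : termFnRing f n) : (Fin n → K) → K) x * y ^ e := by
  rw [polyAt, eval_eq_sum_range' (lt_of_le_of_lt (natDegree_map_le) (Nat.lt_succ_self _))]
  refine Finset.sum_congr rfl fun e _ => ?_
  rw [coeff_map]
  rfl

/-- Coefficients of `polyAt`. [folklore] -/
theorem coeff_polyAt (P : Polynomial M) (x : Fin n → K) (e : ℕ) :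
    (polyAt P x).coeff e = (((P.coeff e : M) : termFnRing f n) : (Fin n → K) → K) x := by
  rw [polyAt, coeff_map]
  rfl

/-- The coefficientwise-derivative sum of `pd_eval`, as a sum over `range`. [folklore] -/
theorem sum_pd_eq (l : Fin n) (P : Polynomial M) (Y : termFnRing f n) :
    ((P.map M.subtype).sum fun i a => pd f n l a * Y ^ i) =
      ∑ i ∈ Finset.range (P.natDegree + 1), pd f n l ((P.coeff i : M) : termFnRing f n) * Y ^ i := by
  rw [Polynomial.sum_def]
  have hsub : (P.map M.subtype).support ⊆ Finset.range (P.natDegree + 1) :=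
    (supp_subset_range_natDegree_succ).trans
      (Finset.range_mono (Nat.succ_le_succ natDegree_map_le))
  rw [Finset.sum_subset hsub]
  · refine Finset.sum_congr rfl fun i _ => ?_
    rw [coeff_map]; rfl
  · intro i _ hi
    rw [Polynomial.notMem_support_iff.1 hi, pd_zero, zero_mul]

/-- **The coefficientwise derivative** `Σ (∂aᵢ/∂xₗ) Tⁱ` of a polynomial over a subring `M` closed
under `∂/∂xₗ`. [folklore] -/
def pdPoly (l : Fin n) (hM : ∀ m ∈ M, pd f n l m ∈ M) (P : Polynomial M) : Polynomial M :=
  ∑ i ∈ Finset.range (P.natDegree + 1), C ⟨pd f n l ((P.coeff i : M) : termFnRing f n), hM _ (P.coeff i).2⟩ * X ^ i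

/-- Evaluation of the coefficientwise derivative. [folklore] -/
theorem eval_pdPoly (l : Fin n) (hM : ∀ m ∈ M, pd f n l m ∈ M) (P : Polynomial M)
    (Y : termFnRing f n) :
    ((pdPoly l hM P).map M.subtype).eval Y =
      ∑ i ∈ Finset.range (P.natDegree + 1), pd f n l ((P.coeff i : M) : termFnRing f n) * Y ^ i := by
  rw [pdPoly, Polynomial.map_sum, eval_finsetSum]
  refine Finset.sum_congr rfl fun i _ => ?_
  rw [Polynomial.map_mul, Polynomial.map_pow, map_C, map_X, eval_mul, eval_pow, eval_C, eval_X]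
  rfl

/-- Degree of the coefficientwise derivative. [folklore] -/
theorem natDegree_pdPoly_le (l : Fin n) (hM : ∀ m ∈ M, pd f n l m ∈ M) (P : Polynomial M) :
    (pdPoly l hM P).natDegree ≤ P.natDegree := by
  rw [pdPoly]
  refine natDegree_sum_le_of_forall_le _ _ fun i hi => ?_
  exact (natDegree_C_mul_X_pow_le _ _).trans (Nat.lt_succ_iff.1 (Finset.mem_range.1 hi))

/-- Constant coefficient of the coefficientwise derivative. [folklore] -/
theorem coeff_pdPoly_zero (l : Fin n) (hM : ∀ m ∈ M, pd f n l m ∈ M) (P : Polynomial M) :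
    ((pdPoly l hM P).coeff 0 : termFnRing f n) = pd f n l ((P.coeff 0 : M) : termFnRing f n) := by
  rw [pdPoly, finsetSum_coeff]
  simp only [coeff_C_mul_X_pow]
  rw [Finset.sum_ite_eq]
  simp

end Degrees

/-! ### Case 2 of the proof of Lemma 1: a counterexample of minimal degree -/

section Step

variable {f n}

/-- Clause (3) of Lemma 1 at stage `j` for the system `F` ("for any `β̄ ∈ S` and `h ∈ Mⱼ`, if
`h₁(β̄) = ⋯ = hₚ(β̄) = h(β̄) = 0` and `(dh₁ ∧ ⋯ ∧ dhₚ)(β̄) ≠ 0` then `h` vanishes on `V(h₁, …, hₚ)`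
close to `β̄`"; the alternative `p = n` is kept separate).  This is the inductive hypothesis (3)ⱼ of
the printed proof (p. 391: "Denote the corresponding three conditions by (1)ⱼ, (2)ⱼ and (3)ⱼ"), a
*predicate* on the stage `j` and the system `F` — not a closed statement: its closure over all
stages and systems is false (`not_clause3_emptySystem`, `not_forall_clause3` below; the failure of
(3)ⱼ₊₁ for the current system is precisely Case 2 of the proof).  What Lemma 1 asserts is the
existence of a system satisfying it at every stage (`lemma1_main`, `Wilkie1989_lemma1_holds`).
[cite: Wilkie1989, Lemma 1] -/
def Clause3 (S : Set (Fin n → K)) (g : ℕ → termFnRing f n) (j : ℕ) {p : ℕ}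
    (F : Fin p → termFnRing f n) : Prop :=
  ∀ β ∈ S, β ∈ VnsF f n F → ∀ G ∈ chain f n g j, ((G : termFnRing f n) : (Fin n → K) → K) β = 0 →
    VCT f n G F β

/-- **Clause (3)ⱼ is a condition on the stage and the system, not a standalone fact.** Already for
`n = 1`, the empty system (`p = 0 < n`), `S = K¹` and stage `j = 1` (`M₁ = k[x₁]`) it fails:
`x₁ ∈ M₁` vanishes at the non-singular zero `0̄` of the empty system but on no neighbourhood of
it in `V(∅) = K¹` — the situation from which Case 2 of the printed proof starts (it then adjoins
`h₁ = x₁`, of minimal degree `1`, reaching `p = n`). [cite: Wilkie1989, proof of Lemma 1, p. 392] -/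
theorem not_clause3_emptySystem (g : ℕ → termFnRing f 1) :
    ¬ Clause3 (Set.univ : Set (Fin 1 → K)) g 1 (Fin.elim0 : Fin 0 → termFnRing f 1) := by
  intro h
  have hβV : (0 : Fin 1 → K) ∈ VnsF f 1 (Fin.elim0 : Fin 0 → termFnRing f 1) :=
    ⟨fun r => r.elim0, linearIndependent_empty_type⟩
  have hG : coordFn f 1 0 ∈ chain f 1 g 1 := by
    simpa using coordFn_mem_chain f 1 g 0
  obtain ⟨ε, hε, hball⟩ := h 0 (Set.mem_univ _) hβV (coordFn f 1 0) hG (by simp)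
  -- the point `(δ)`, `δ = min ε 1 / 2`, lies in the ball of radius `ε` around `0̄`, yet `x₁ = δ ≠ 0` there
  set δ : K := min ε 1 / 2 with hδ
  have hmin1 : min ε 1 ≤ 1 := min_le_right _ _
  have hminε : min ε 1 ≤ ε := min_le_left _ _
  have hmin0 : 0 < min ε 1 := lt_min hε one_pos
  have hδpos : 0 < δ := by rw [hδ]; linarith
  have hδ1 : δ < 1 := by rw [hδ]; linarith
  have hδε : δ < ε := by rw [hδ]; linarith
  have hsq : δ ^ 2 < ε :=
    calc δ ^ 2 = δ * δ := sq δ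
      _ < 1 * δ := mul_lt_mul_of_pos_right hδ1 hδpos
      _ = δ := one_mul δ
      _ < ε := hδε
  have hx := hball (fun _ => δ) (by simpa using hsq) (fun r => r.elim0)
  simp only [coe_coordFn] at hx
  exact hδpos.ne' hx

/-- Hence the closure of `Clause3` over all dimensions, sets, chains, stages and systems is false
in every model `K ⊨ T_exp` over every `k`: there is no unconditional "`Clause3` holds"; the content
of Lemma 1 is `lemma1_main` / `Wilkie1989_lemma1_holds`. [cite: Wilkie1989, proof of Lemma 1, p. 392] -/
theorem not_forall_clause3 :
    ¬ ∀ (n : ℕ) (S : Set (Fin n → K)) (g : ℕ → termFnRing f n) (j p : ℕ)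
        (F : Fin p → termFnRing f n), Clause3 S g j F :=
  fun h => not_clause3_emptySystem (fun _ => 0) (h 1 Set.univ (fun _ => 0) 1 0 Fin.elim0)

variable {S : Set (Fin n → K)} {g : ℕ → termFnRing f n} {j : ℕ} {p : ℕ} {F : Fin p → termFnRing f n}

/-- **The data of Case 2 with minimal degree** (Wilkie 1989, p. 392, (∗) and "we may suppose that
`s` is minimal such that (∗) holds, witnessed by `β̄`"): a stage `j`, a system `F` of `p < n`
functions in `Mⱼ` satisfying (3)ⱼ, and `G = P(Yⱼ) ∈ Mⱼ₊₁` of exact degree `s ≥ 1` vanishing at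
`β ∈ S ∩ Vⁿˢ(F)` but not vanishing on `V(F)` close to `β`, with `s` minimal: every element of
`Mⱼ₊₁` of degree `< s` vanishing at a point of `S ∩ Vⁿˢ(F)` vanishes on `V(F)` close to it.
[cite: Wilkie1989, proof of Lemma 1, p. 392] -/
structure MinBad (S : Set (Fin n → K)) (j : ℕ) {p : ℕ} (F : Fin p → termFnRing f n)
    (G : termFnRing f n) (β : Fin n → K) (P : Polynomial (chain f n g j)) (s : ℕ) : Prop where
  hpn : p < n
  hF : ∀ r, F r ∈ chain f n g j
  hPs : P.natDegree = s
  hs : 0 < s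
  hPG : (P.map (chain f n g j).subtype).eval (chainGen f n g j) = G
  hβS : β ∈ S
  hβV : β ∈ VnsF f n F
  hGβ : ((G : termFnRing f n) : (Fin n → K) → K) β = 0
  hbad : ¬ VCT f n G F β
  hmin : ∀ (G' : termFnRing f n) (β' : Fin n → K),
    DegLT (chain f n g j) (chainGen f n g j) G' s → β' ∈ S → β' ∈ VnsF f n F →
      ((G' : termFnRing f n) : (Fin n → K) → K) β' = 0 → VCT f n G' F β'

/-- **Case 2: existence of a counterexample of minimal degree.** If (3)ⱼ holds for `F` (`p < n`
functions in `Mⱼ`) but (3)ⱼ₊₁ fails, there is a `MinBad` datum. [cite: Wilkie1989, proof of Lemma 1, p. 392] -/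
theorem MinBad.exists (hpn : p < n) (hF : ∀ r, F r ∈ chain f n g j) (h3 : Clause3 S g j F)
    (hfail : ¬ Clause3 S g (j + 1) F) :
    ∃ (G : termFnRing f n) (β : Fin n → K) (P : Polynomial (chain f n g j)) (s : ℕ),
      MinBad S j F G β P s := by
  classical
  -- bad pairs of degree `≤ d`
  let Bad : ℕ → Prop := fun d => ∃ (G : termFnRing f n) (β : Fin n → K)
    (P : Polynomial (chain f n g j)),
    P.natDegree ≤ d ∧ (P.map (chain f n g j).subtype).eval (chainGen f n g j) = G ∧
      β ∈ S ∧ β ∈ VnsF f n F ∧ ((G : termFnRing f n) : (Fin n → K) → K) β = 0 ∧ ¬ VCT f n G F β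
  have hex : ∃ d, Bad d := by
    simp only [Clause3, not_forall, exists_prop] at hfail
    obtain ⟨β, hβS, hβV, G, hG, hGβ, hbad⟩ := hfail
    obtain ⟨P, hP⟩ := (mem_chain_succ f n g).1 hG
    exact ⟨P.natDegree, G, β, P, le_rfl, hP, hβS, hβV, hGβ, hbad⟩
  set s := Nat.find hex with hs
  obtain ⟨G, β, P, hPd, hPG, hβS, hβV, hGβ, hbad⟩ : Bad s := Nat.find_spec hex
  have hmin : ∀ (G' : termFnRing f n) (β' : Fin n → K),
      DegLT (chain f n g j) (chainGen f n g j) G' s → β' ∈ S →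
      β' ∈ VnsF f n F → ((G' : termFnRing f n) : (Fin n → K) → K) β' = 0 → VCT f n G' F β' := by
    intro G' β' ⟨P', hP', hP'G⟩ hβ'S hβ'V hG'β'
    by_contra hbad'
    have hs0 : 0 < s := lt_of_le_of_lt (Nat.zero_le _) hP'
    have : Bad (s - 1) := ⟨G', β', P', by omega, hP'G, hβ'S, hβ'V, hG'β', hbad'⟩
    exact Nat.find_min hex (by omega : s - 1 < s) this
  have hs0 : 0 < s := by
    by_contra h0
    have h0' : s = 0 := by omega
    have hP0 : P.natDegree ≤ 0 := by rw [← h0']; exact hPd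
    have hGM : G ∈ chain f n g j := by
      rw [← hPG, eq_C_of_natDegree_le_zero hP0]
      simp
    exact hbad (h3 β hβS hβV G hGM hGβ)
  have hPs : P.natDegree = s := by
    rcases hPd.lt_or_eq with hlt | heq
    · exact (hbad (hmin G β ⟨P, hlt, hPG⟩ hβS hβV hGβ)).elim
    · exact heq
  exact ⟨G, β, P, s, ⟨hpn, hF, hPs, hs0, hPG, hβS, hβV, hGβ, hbad, hmin⟩⟩

namespace MinBad

variable {G : termFnRing f n} {β : Fin n → K} {P : Polynomial (chain f n g j)} {s : ℕ}

/-- Elements of `Mⱼ` vanishing at a point of `S ∩ Vⁿˢ(F)` vanish on `V(F)` close to it (degree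
`0 < s`). [cite: Wilkie1989, proof of Lemma 1, p. 392] -/
theorem vct_of_mem (h : MinBad S j F G β P s) {m : termFnRing f n} (hm : m ∈ chain f n g j)
    {β' : Fin n → K} (hβ'S : β' ∈ S) (hβ'V : β' ∈ VnsF f n F)
    (hmβ' : ((m : termFnRing f n) : (Fin n → K) → K) β' = 0) : VCT f n m F β' :=
  h.hmin m β' (degLT_of_mem hm h.hs) hβ'S hβ'V hmβ'

/-- **Subcase 2(a), (2)ⱼ₊₁** (`j < n`, `Mⱼ₊₁ = Mⱼ[xⱼ₊₁]`; Wilkie 1989, pp. 392–393): the gradient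
row of `G` at `β` is not in the span of the (independent) rows `∇Fᵣ(β)`, i.e.
`(dF₁ ∧ ⋯ ∧ dFₚ ∧ dG)(β̄) ≠ 0`.  Otherwise `∂G/∂xⱼ₊₁(β̄) = 0` (the rows `∇Fᵣ` vanish in the
columns `> j`), `∂G/∂xⱼ₊₁` has degree `< s` and so vanishes on `V(F)` close to `β̄`, in particular
on the segment `{β̄[xⱼ₊₁ ↦ y]}`; hence the polynomial `Σ i aᵢ(β̄) yⁱ⁻¹` is identically zero, all
`aᵢ(β̄) = 0`, each `aᵢ` vanishes close to `β̄`, and so does `G`: contradiction. [cite: Wilkie1989, proof of Lemma 1, pp. 392–393] -/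
theorem jrow_not_mem_span_of_lt (h : MinBad S j F G β P s) (hjn : j < n) :
    jrow f n G β ∉ Submodule.span K (Set.range fun r => jrow f n (F r) β) := by
  classical
  intro hmem
  set jj : Fin n := ⟨j, hjn⟩ with hjj
  have hY : chainGen f n g j = coordFn f n jj := chainGen_of_lt f n g hjn
  -- (a) the rows vanish in the columns `≥ j`, hence so does `∇G(β)` in the column `j`
  have hspan0 : ∀ v ∈ Submodule.span K (Set.range fun r => jrow f n (F r) β), v jj = 0 := by
    intro v hv
    induction hv using Submodule.span_induction with
    | mem v hv =>
      obtain ⟨r, rfl⟩ := hv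
      show ((pd f n jj (F r) : termFnRing f n) : (Fin n → K) → K) β = 0
      rw [pd_eq_zero_of_mem_chain f n g hjn.le (h.hF r) jj le_rfl]
      rfl
    | zero => rfl
    | add v w _ _ hv hw => rw [Pi.add_apply, hv, hw, add_zero]
    | smul c v _ hv => rw [Pi.smul_apply, hv, smul_zero]
  have hG0 : jrow f n G β jj = 0 := hspan0 _ hmem
  -- (b) `∂G/∂xⱼ₊₁ = P'(xⱼ₊₁)`
  set G' : termFnRing f n := ((derivative P).map (chain f n g j).subtype).eval (coordFn f n jj)
    with hG'def
  have hpdG : pd f n jj G = G' := by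
    rw [← h.hPG, hY, pd_eval]
    have h1 : ((P.map (chain f n g j).subtype).sum fun i a => pd f n jj a * coordFn f n jj ^ i) = 0 := by
      refine Finset.sum_eq_zero fun i _ => ?_
      have hmem' : ((P.map (chain f n g j).subtype).coeff i : termFnRing f n) ∈ chain f n g j := by
        rw [coeff_map]; exact (P.coeff i).2
      dsimp only
      rw [pd_eq_zero_of_mem_chain f n g hjn.le hmem' jj le_rfl, zero_mul]
    rw [h1, zero_add, pd_coordFn, if_pos rfl, mul_one, derivative_map]
  have hG'deg : DegLT (chain f n g j) (chainGen f n g j) G' s := by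
    rw [hY]
    refine degLT_eval (lt_of_le_of_lt (natDegree_derivative_le P) ?_)
    have h1 := h.hPs
    have h2 := h.hs
    omega
  have hG'β : ((G' : termFnRing f n) : (Fin n → K) → K) β = 0 := by
    have e : ((G' : termFnRing f n) : (Fin n → K) → K) β = jrow f n G β jj := by
      rw [← hpdG]; rfl
    rw [e, hG0]
  obtain ⟨ε, hε, hG'loc⟩ := h.hmin G' β hG'deg h.hβS h.hβV hG'β
  -- (c) `G'` vanishes on the segment `β[xⱼ₊₁ ↦ y]`, `(y - βⱼ₊₁)² < ε`
  have hupd : ∀ y : K, (y - β jj) ^ 2 < ε →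
      ((G' : termFnRing f n) : (Fin n → K) → K) (Function.update β jj y) = 0 := by
    intro y hy
    apply hG'loc
    · rw [Finset.sum_eq_single jj]
      · simpa using hy
      · intro l _ hl
        rw [Function.update_of_ne hl, sub_self]
        simp
      · simp
    · intro r
      rw [apply_eq_of_mem_chain f n g hjn.le (h.hF r) (Function.update β jj y) β (fun i hi =>
        Function.update_of_ne (fun e => by subst e; exact lt_irrefl _ hi) _ _)]
      exact h.hβV.1 r
  -- (d) the polynomial `Σ P'.coeff e (β) yᵉ` has infinitely many roots, hence is zero
  set R : Polynomial K := polyAt (derivative P) β with hR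
  have hReval : ∀ y : K, R.eval y =
      ((G' : termFnRing f n) : (Fin n → K) → K) (Function.update β jj y) := by
    intro y
    rw [hR, eval_polyAt, hG'def, coe_eval_apply]
    refine Finset.sum_congr rfl fun e _ => ?_
    rw [coe_coordFn, Function.update_self]
    congr 1
    exact apply_eq_of_mem_chain f n g hjn.le ((derivative P).coeff e).2 β (Function.update β jj y)
      (fun i hi => (Function.update_of_ne (fun e => by subst e; exact lt_irrefl _ hi) _ _).symm)
  have hRzero : R = 0 := by
    apply eq_zero_of_infinite_isRoot
    set δ : K := min 1 ε with hδ
    have hδ0 : 0 < δ := lt_min one_pos hε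
    have hsub : Set.Ioo (β jj - δ) (β jj + δ) ⊆ {y | IsRoot R y} := by
      intro y hy
      rw [Set.mem_setOf_eq, IsRoot, hReval]
      apply hupd
      have h1 : |y - β jj| < δ := by
        rw [abs_lt]; constructor <;> linarith [hy.1, hy.2]
      have h2 : (y - β jj) ^ 2 < δ ^ 2 := by
        rw [← sq_abs]
        exact pow_lt_pow_left₀ h1 (abs_nonneg _) two_ne_zero
      have h3 : δ ^ 2 ≤ δ := by
        have : δ ≤ 1 := min_le_left _ _
        nlinarith
      linarith [min_le_right (1 : K) ε]
    exact Set.Infinite.mono hsub (Set.Ioo_infinite (by linarith))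
  -- (e) all coefficients of `P` vanish at `β`
  have hcoef_succ : ∀ i : ℕ,
      (((P.coeff (i + 1) : chain f n g j) : termFnRing f n) : (Fin n → K) → K) β = 0 := by
    intro i
    have h1 : R.coeff i = 0 := by rw [hRzero, coeff_zero]
    rw [hR, coeff_polyAt, coeff_derivative] at h1
    push_cast at h1
    rw [Pi.mul_apply, Pi.add_apply, Pi.natCast_apply, Pi.one_apply] at h1
    exact (mul_eq_zero.1 h1).resolve_right (Nat.cast_add_one_ne_zero i)
  have hcoef : ∀ i : ℕ, (((P.coeff i : chain f n g j) : termFnRing f n) : (Fin n → K) → K) β = 0 := by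
    intro i
    rcases i with _ | i
    · have hGβ := h.hGβ
      rw [← h.hPG, hY, coe_eval_apply, Finset.sum_range_succ'] at hGβ
      rw [Finset.sum_eq_zero (fun e _ => by rw [hcoef_succ e, zero_mul]), zero_add, pow_zero,
        mul_one] at hGβ
      exact hGβ
    · exact hcoef_succ i
  -- (f) hence `G` vanishes on `V(F)` close to `β`: contradiction
  obtain ⟨ε', hε', hall⟩ := vct_finset (Finset.range (P.natDegree + 1))
    (G := fun i => ((P.coeff i : chain f n g j) : termFnRing f n)) (F := F) (β := β)
    (fun i _ => h.vct_of_mem (P.coeff i).2 h.hβS h.hβV (hcoef i))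
  refine h.hbad ⟨ε', hε', fun x hx hV => ?_⟩
  rw [← h.hPG, hY, coe_eval_apply]
  exact Finset.sum_eq_zero fun e he => by rw [hall e he x hx hV, zero_mul]

/-- **Subcase 2(b), (2)ⱼ₊₁** (`j ≥ n`, `Mⱼ₊₁ = Mⱼ[e^g]`; Wilkie 1989, pp. 393–394): the gradient
row of `G` at `β` is not in the span of the rows `∇Fᵣ(β)`.  Otherwise, with `a₀` the constant
coefficient of `G = Σ aᵢ e^{ig}`: the rows `a₀ ∇G - G ∇a₀` are `e^g`-multiples of elements of
degree `< s`, so every maximal minor of `(∇F₁, …, ∇Fₚ, a₀∇G - G∇a₀)` is `e^g · q(e^g)` with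
`deg q < s`; these vanish at `β̄` hence (minimality) on `V(F)` close to `β̄`; `a₀(β̄) ≠ 0`
(otherwise `a₀` and `e^{-g}(G - a₀)` vanish close to `β̄`, hence `G`); so by §2
(`vct_of_wedge`) `G/a₀` is constant, hence `0`, on `V(F)` close to `β̄`: contradiction.
[cite: Wilkie1989, proof of Lemma 1, pp. 393–394] -/
theorem jrow_not_mem_span_of_le (h : MinBad S j F G β P s)
    (hg : ∀ i, n ≤ i → g i ∈ chain f n g i) (hnj : n ≤ j) :
    jrow f n G β ∉ Submodule.span K (Set.range fun r => jrow f n (F r) β) := by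
  classical
  intro hmem
  set Y : termFnRing f n := chainGen f n g j with hYdef
  have hY : Y = expFn f n (g j) := chainGen_of_le f n g hnj
  have hYne : ∀ x : Fin n → K, ((Y : termFnRing f n) : (Fin n → K) → K) x ≠ 0 := by
    intro x; rw [hY]; exact expFn_apply_ne_zero f n _ x
  have hYmem : Y ∈ chain f n g (j + 1) := chainGen_mem f n g j
  have hPG : (P.map (chain f n g j).subtype).eval Y = G := h.hPG
  have hM_pd : ∀ l : Fin n, ∀ m ∈ chain f n g j, pd f n l m ∈ chain f n g j :=
    fun l m hm => pd_mem_chain f n g hg hm l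
  set a₀ : termFnRing f n := ((P.coeff 0 : chain f n g j) : termFnRing f n) with ha₀def
  have ha₀M : a₀ ∈ chain f n g j := (P.coeff 0).2
  -- a ring identity used below, proved abstractly (so that `ring` runs on opaque atoms)
  have ringId : ∀ {R : Type} [CommRing R] (a b c d : R), a * (b * c) * d = b * (c * (a * d)) := by
    intros; ring
  -- the splitting `G = a₀ + Y · G₁`, `deg G₁ < s`
  set G₁ : termFnRing f n := ((P.divX).map (chain f n g j).subtype).eval Y with hG₁def
  have hG₁deg : DegLT (chain f n g j) Y G₁ s := by
    refine degLT_eval ?_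
    rw [natDegree_divX_eq_natDegree_tsub_one, h.hPs]
    have := h.hs; omega
  have hsplit : G = a₀ + Y * G₁ := by
    have e := congrArg (fun Q : Polynomial (chain f n g j) => (Q.map (chain f n g j).subtype).eval Y)
      (X_mul_divX_add P)
    simp only [Polynomial.map_add, Polynomial.map_mul, map_X, map_C, eval_add, eval_mul, eval_X,
      eval_C] at e
    rw [hPG] at e
    rw [← e, add_comm]
    rfl
  -- (a) `a₀(β) ≠ 0`
  have ha₀β : ((a₀ : termFnRing f n) : (Fin n → K) → K) β ≠ 0 := by
    intro h0
    obtain ⟨ε₁, hε₁, H₁⟩ := h.vct_of_mem ha₀M h.hβS h.hβV h0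
    have hG₁β : ((G₁ : termFnRing f n) : (Fin n → K) → K) β = 0 := by
      have e : ((G : termFnRing f n) : (Fin n → K) → K) β =
          (((a₀ + Y * G₁ : termFnRing f n)) : (Fin n → K) → K) β := by rw [← hsplit]
      rw [h.hGβ] at e
      push_cast at e
      rw [Pi.add_apply, Pi.mul_apply, h0, zero_add] at e
      exact (mul_eq_zero.1 e.symm).resolve_left (hYne β)
    obtain ⟨ε₂, hε₂, H₂⟩ := h.hmin G₁ β hG₁deg h.hβS h.hβV hG₁β
    refine h.hbad ⟨min ε₁ ε₂, lt_min hε₁ hε₂, fun x hx hV => ?_⟩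
    rw [hsplit]
    push_cast
    rw [Pi.add_apply, Pi.mul_apply, H₁ x (lt_of_lt_of_le hx (min_le_left _ _)) hV,
      H₂ x (lt_of_lt_of_le hx (min_le_right _ _)) hV, zero_add, mul_zero]
  -- (b) the wedge rows `a₀ ∂G - G ∂a₀ = Y · W'ₗ` with `deg W'ₗ < s`
  have hW : ∀ l : Fin n, ∃ W' : termFnRing f n, DegLT (chain f n g j) Y W' s ∧
      a₀ * pd f n l G - G * pd f n l a₀ = Y * W' := by
    intro l
    set dg : chain f n g j := ⟨pd f n l (g j), hM_pd l _ (hg j hnj)⟩ with hdg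
    set da : chain f n g j := ⟨pd f n l a₀, hM_pd l _ ha₀M⟩ with hda
    set Bl : Polynomial (chain f n g j) := pdPoly l (hM_pd l) P + derivative P * X * C dg with hBl
    have hBl_eval : (Bl.map (chain f n g j).subtype).eval Y = pd f n l G := by
      rw [← hPG, pd_eval, sum_pd_eq]
      simp only [hBl, Polynomial.map_add, Polynomial.map_mul, map_X, map_C, eval_add, eval_mul,
        eval_X, eval_C, eval_pdPoly, derivative_map]
      congr 1
      rw [hY, pd_expFn, ← hY]
      rw [mul_assoc]
      rfl
    have hBl_deg : Bl.natDegree ≤ s := by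
      refine (natDegree_add_le _ _).trans (max_le ?_ ?_)
      · exact (natDegree_pdPoly_le _ _ _).trans h.hPs.le
      · refine (natDegree_mul_C_le _ _).trans ((natDegree_mul_le).trans ?_)
        have h1 := natDegree_derivative_le P
        have h2 : (X : Polynomial (chain f n g j)).natDegree ≤ 1 := natDegree_X_le
        have := h.hPs; have := h.hs; omega
    set Cl : Polynomial (chain f n g j) := C (P.coeff 0) * Bl - P * C da with hCl
    have hCl_eval : (Cl.map (chain f n g j).subtype).eval Y = a₀ * pd f n l G - G * pd f n l a₀ := by
      rw [hCl]
      simp only [Polynomial.map_sub, Polynomial.map_mul, map_C, eval_sub, eval_mul, eval_C,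
        hBl_eval, hPG]
      rfl
    have hCl_deg : Cl.natDegree ≤ s := by
      refine (natDegree_sub_le _ _).trans (max_le ?_ ?_)
      · exact (natDegree_C_mul_le _ _).trans hBl_deg
      · exact (natDegree_mul_C_le _ _).trans h.hPs.le
    have hpd0 : (pdPoly l (hM_pd l) P).coeff 0 = da :=
      Subtype.ext (by rw [coeff_pdPoly_zero])
    have hCl0 : Cl.coeff 0 = 0 := by
      rw [hCl, coeff_sub, coeff_C_mul, coeff_mul_C, hBl, coeff_add, coeff_mul_C, coeff_mul_X_zero,
        zero_mul, add_zero, hpd0, sub_self]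
    have hXd : X * Cl.divX = Cl := by
      conv_rhs => rw [← X_mul_divX_add Cl]
      rw [hCl0, C_0, add_zero]
    refine ⟨((Cl.divX).map (chain f n g j).subtype).eval Y, degLT_eval ?_, ?_⟩
    · rw [natDegree_divX_eq_natDegree_tsub_one]
      have := h.hs; omega
    · rw [← hCl_eval]
      conv_lhs => rw [← hXd, Polynomial.map_mul, map_X, eval_mul, eval_X]
  choose W' hW'deg hW'eq using hW
  -- the wedge row at a point
  set w : (Fin n → K) → Fin n → K := fun x =>
    ((a₀ : termFnRing f n) : (Fin n → K) → K) x • jrow f n G x -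
      ((G : termFnRing f n) : (Fin n → K) → K) x • jrow f n a₀ x with hwdef
  have hw : ∀ x l, w x l = ((Y : termFnRing f n) : (Fin n → K) → K) x *
      ((W' l : termFnRing f n) : (Fin n → K) → K) x := by
    intro x l
    have e : (((a₀ * pd f n l G - G * pd f n l a₀ : termFnRing f n)) : (Fin n → K) → K) x =
        (((Y * W' l : termFnRing f n)) : (Fin n → K) → K) x := by rw [hW'eq l]
    push_cast at e
    simp only [Pi.sub_apply, Pi.mul_apply] at e
    simp only [hwdef, Pi.sub_apply, Pi.smul_apply, smul_eq_mul, jrow]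
    rw [← e]
  -- (c) the maximal minors `D_I = Y · E_I`, `deg E_I < s`
  -- the `p × p` minors of the Jacobian of `F` on columns `I ∘ c.succAbove` are in `Mⱼ`
  set minorM : (Fin (p + 1) → Fin n) → Fin (p + 1) → chain f n g j := fun I c =>
    Matrix.det (Matrix.of fun r c' =>
      (⟨pd f n (I (c.succAbove c')) (F r), hM_pd _ _ (h.hF r)⟩ : chain f n g j)) with hminorM
  set EI : (Fin (p + 1) → Fin n) → termFnRing f n := fun I =>
    ∑ c : Fin (p + 1), W' (I c) * ((((-1 : termFnRing f n) ^ ((p : ℕ) + (c : ℕ))) *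
      (minorM I c : termFnRing f n))) with hEI
  have hEIdeg : ∀ I, DegLT (chain f n g j) Y (EI I) s := by
    intro I
    rw [hEI]
    refine DegLT.sum _ h.hs fun c _ => (hW'deg _).mul_mem ?_
    exact Subring.mul_mem _ (Subring.pow_mem _ (Subring.neg_mem _ (Subring.one_mem _)) _) (minorM I c).2
  -- the function matrix `[∇F ; w]` on the columns `I` and its determinant
  set NI : (Fin (p + 1) → Fin n) → Matrix (Fin (p + 1)) (Fin (p + 1)) (termFnRing f n) := fun I =>
    Matrix.of (Fin.snoc (fun r c => pd f n (I c) (F r))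
      (fun c => a₀ * pd f n (I c) G - G * pd f n (I c) a₀)) with hNI
  have hNIdet : ∀ I, (NI I).det = Y * EI I := by
    intro I
    rw [Matrix.det_succ_row _ (Fin.last p), hEI, Finset.mul_sum]
    refine Finset.sum_congr rfl fun c _ => ?_
    have e1 : NI I (Fin.last p) c = Y * W' (I c) := by
      simp only [hNI, Matrix.of_apply, Fin.snoc_last]; exact hW'eq (I c)
    have e2 : ((NI I).submatrix (Fin.last p).succAbove c.succAbove).det =
        (minorM I c : termFnRing f n) := by
      simp only [hminorM]
      rw [← Subring.coe_subtype, RingHom.map_det]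
      congr 1
      ext r c'
      rw [Matrix.submatrix_apply, Fin.succAbove_last, RingHom.mapMatrix_apply, Matrix.map_apply]
      simp only [hNI, Matrix.of_apply, Fin.snoc_castSucc]
      rfl
    rw [e1, e2, Fin.val_last]
    exact ringId _ _ _ _
  -- its values are the minors of the `K`-matrix `[∇F(x) ; w(x)]`
  set NK : (Fin n → K) → Matrix (Fin (p + 1)) (Fin n) K := fun x =>
    Matrix.of (Fin.snoc (fun r => jrow f n (F r) x) (w x)) with hNK
  have hNIval : ∀ I x, (((NI I).det : termFnRing f n) : (Fin n → K) → K) x =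
      ((NK x).submatrix _root_.id I).det := by
    intro I x
    rw [← evalAt_apply f n x, RingHom.map_det]
    congr 1
    ext r c
    simp only [RingHom.mapMatrix_apply, Matrix.map_apply, evalAt_apply, Matrix.submatrix_apply,
      id_eq, hNK, Matrix.of_apply]
    refine Fin.lastCases ?_ (fun r => ?_) r
    · simp only [hNI, Matrix.of_apply, Fin.snoc_last]
      push_cast
      simp only [Pi.sub_apply, Pi.mul_apply, hwdef, Pi.smul_apply, smul_eq_mul, jrow]
    · simp only [hNI, Matrix.of_apply, Fin.snoc_castSucc, jrow]
  -- (d) all `E_I` vanish at `β`, hence on `V(F)` close to `β`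
  have hwβ : w β ∈ Submodule.span K (Set.range fun r => jrow f n (F r) β) := by
    simp only [hwdef, h.hGβ, zero_smul, sub_zero]
    exact Submodule.smul_mem _ _ hmem
  have hEIβ : ∀ I, ((EI I : termFnRing f n) : (Fin n → K) → K) β = 0 := by
    intro I
    have hdet : ((NK β).submatrix _root_.id I).det = 0 := by
      by_contra hne
      have hli := linearIndependent_rows_of_det_submatrix_ne_zero (NK β) I hne
      have : (fun i => NK β i) = Fin.snoc (fun r => jrow f n (F r) β) (w β) := by
        funext i; rw [hNK]; rfl
      rw [this, linearIndependent_finSnoc] at hli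
      exact hli.2 hwβ
    have e := hNIval I β
    rw [hdet, hNIdet] at e
    push_cast at e
    rw [Pi.mul_apply] at e
    exact (mul_eq_zero.1 e).resolve_left (hYne β)
  obtain ⟨ε₃, hε₃, H₃⟩ := vct_finset (Finset.univ : Finset (Fin (p + 1) → Fin n)) (G := EI)
    (F := F) (β := β) (fun I _ => h.hmin (EI I) β (hEIdeg I) h.hβS h.hβV (hEIβ I))
  -- (e) the rows `∇F(x)` stay independent near `β`
  obtain ⟨I₀, -, hI₀⟩ := exists_det_submatrix_ne_zero_of_linearIndependent_rows
    (Matrix.of fun r => jrow f n (F r) β) h.hβV.2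
  set m₀ : termFnRing f n := Matrix.det (Matrix.of fun r c => pd f n (I₀ c) (F r)) with hm₀
  have hm₀val : ∀ x, ((m₀ : termFnRing f n) : (Fin n → K) → K) x =
      ((Matrix.of fun r => jrow f n (F r) x).submatrix _root_.id I₀).det := by
    intro x
    rw [← evalAt_apply f n x, RingHom.map_det]
    congr 1
  obtain ⟨ε₄, hε₄, H₄⟩ := exists_ball_ne_zero' m₀ β (by rw [hm₀val]; exact hI₀)
  -- (f) §2: `G/a₀` is constant, hence `0`, on `V(F)` close to `β`
  refine h.hbad (vct_of_wedge h.hβV.1 h.hβV.2 ha₀β h.hGβ (lt_min hε₃ hε₄) fun x hx hV => ?_)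
  have hrows : LinearIndependent K (fun r => jrow f n (F r) x) := by
    have := H₄ x (lt_of_lt_of_le hx (min_le_right _ _))
    rw [hm₀val] at this
    exact linearIndependent_rows_of_det_submatrix_ne_zero (Matrix.of fun r => jrow f n (F r) x) I₀ this
  have hdep : ¬ LinearIndependent K (Fin.snoc (fun r => jrow f n (F r) x) (w x) :
      Fin (p + 1) → Fin n → K) := by
    have : (Fin.snoc (fun r => jrow f n (F r) x) (w x) : Fin (p + 1) → Fin n → K) =
        fun i => NK x i := by
      funext i; rw [hNK]; rfl
    rw [this, linearIndependent_rows_iff_exists_det_submatrix_ne_zero, not_exists]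
    intro I hI
    apply hI
    rw [← hNIval, hNIdet]
    push_cast
    rw [Pi.mul_apply, H₃ I (Finset.mem_univ I) x (lt_of_lt_of_le hx (min_le_left _ _)) hV, mul_zero]
  rw [linearIndependent_finSnoc, not_and, not_not] at hdep
  exact hdep hrows

/-- **(2)ⱼ₊₁ for the extended system** (both subcases): `β ∈ Vⁿˢ(F₁, …, Fₚ, G)`.
[cite: Wilkie1989, proof of Lemma 1, pp. 392–394] -/
theorem mem_VnsF_snoc (h : MinBad S j F G β P s) (hg : ∀ i, n ≤ i → g i ∈ chain f n g i) :
    β ∈ VnsF f n (Fin.snoc F G) := by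
  refine ⟨mem_VF_snoc.2 ⟨h.hβV.1, h.hGβ⟩, ?_⟩
  rw [jrow_snoc, linearIndependent_finSnoc]
  refine ⟨h.hβV.2, ?_⟩
  rcases lt_or_ge j n with hjn | hnj
  · exact h.jrow_not_mem_span_of_lt hjn
  · exact h.jrow_not_mem_span_of_le hg hnj

/-- **(3)ⱼ₊₁ for the extended system** (Wilkie 1989, p. 393: "consider any `H ∈ Mⱼ₊₁` and `β̄' ∈ S`
such that `h₁(β̄') = ⋯ = hₚ(β̄') = h(β̄') = H(β̄') = 0` and `(dh₁ ∧ ⋯ ∧ dhₚ ∧ dh)(β̄') ≠ 0`. Now (by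
the Euclidean algorithm) there exist `F₁, F₂ ∈ Mⱼ₊₁`, `m ∈ ℕ` such that `aₛᵐ H = F₁ h + F₂` … where
`F₂` has degree `< s` … `F₂` vanishes on `V(h₁, …, hₚ)` close to `β̄'` … `aₛ(β̄') ≠ 0` and hence (by
transfer) `aₛ` is non-zero throughout some sufficiently small neighbourhood of `β̄'`. It follows
that `H` vanishes on `V(h₁, …, hₚ, h)` close to `β̄'` as required"; the same argument serves
Subcase 2(b), "left to the reader", p. 395). [cite: Wilkie1989, proof of Lemma 1, p. 393] -/
theorem clause3_snoc (h : MinBad S j F G β P s) : Clause3 S g (j + 1) (Fin.snoc F G) := by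
  classical
  intro β' hβ'S hβ'V H hH hHβ'
  set Y : termFnRing f n := chainGen f n g j with hYdef
  have hPG : (P.map (chain f n g j).subtype).eval Y = G := h.hPG
  obtain ⟨hβ'F, hGβ'⟩ := mem_VF_snoc.1 hβ'V.1
  have hLI : LinearIndependent K (Fin.snoc (fun r => jrow f n (F r) β') (jrow f n G β') :
      Fin (p + 1) → Fin n → K) := by
    rw [← jrow_snoc]; exact hβ'V.2
  have hrows : LinearIndependent K (fun r => jrow f n (F r) β') := (linearIndependent_finSnoc.1 hLI).1
  have hβ'ns : β' ∈ VnsF f n F := ⟨hβ'F, hrows⟩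
  have hsub : VF f n (Fin.snoc F G) ⊆ VF f n F := fun x hx => (mem_VF_snoc.1 hx).1
  -- pseudo-division of a representative of `H` by `P`
  obtain ⟨QH, hQH⟩ := (mem_chain_succ f n g).1 hH
  obtain ⟨m, F₁, F₂, hdiv, hF₂⟩ := exists_pseudo_division P (by rw [h.hPs]; exact h.hs) QH
  set a : termFnRing f n := ((P.leadingCoeff : chain f n g j) : termFnRing f n) with hadef
  have haM : a ∈ chain f n g j := (P.leadingCoeff).2
  set R₂ : termFnRing f n := (F₂.map (chain f n g j).subtype).eval Y with hR₂
  have hR₂deg : DegLT (chain f n g j) Y R₂ s := degLT_eval (by rw [← h.hPs]; exact hF₂)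
  have hQH' : (QH.map (chain f n g j).subtype).eval Y = H := hQH
  have heval : a ^ m * H = (F₁.map (chain f n g j).subtype).eval Y * G + R₂ := by
    have e := congrArg (fun Q : Polynomial (chain f n g j) => (Q.map (chain f n g j).subtype).eval Y) hdiv
    simp only [Polynomial.map_mul, Polynomial.map_pow, Polynomial.map_add, map_C, eval_mul, eval_pow,
      eval_add, eval_C, hQH', hPG, map_pow, Subring.coe_subtype] at e
    exact e
  have hevalx : ∀ x : Fin n → K, ((a : termFnRing f n) : (Fin n → K) → K) x ^ m *
      ((H : termFnRing f n) : (Fin n → K) → K) x =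
      (((F₁.map (chain f n g j).subtype).eval Y : termFnRing f n) : (Fin n → K) → K) x *
        ((G : termFnRing f n) : (Fin n → K) → K) x + ((R₂ : termFnRing f n) : (Fin n → K) → K) x := by
    intro x
    have e : (((a ^ m * H : termFnRing f n)) : (Fin n → K) → K) x =
        ((((F₁.map (chain f n g j).subtype).eval Y * G + R₂ : termFnRing f n)) : (Fin n → K) → K) x := by
      rw [heval]
    push_cast at e
    simpa only [Pi.add_apply, Pi.mul_apply, Pi.pow_apply] using e
  -- `R₂` vanishes at `β'`, hence on `V(F)` close to `β'`
  have hR₂β' : ((R₂ : termFnRing f n) : (Fin n → K) → K) β' = 0 := by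
    have e := hevalx β'
    rw [hHβ', hGβ', mul_zero, mul_zero, zero_add] at e
    exact e.symm
  obtain ⟨ε₁, hε₁, H₁⟩ := h.hmin R₂ β' hR₂deg hβ'S hβ'ns hR₂β'
  -- `a(β') ≠ 0`
  have haβ' : ((a : termFnRing f n) : (Fin n → K) → K) β' ≠ 0 := by
    intro h0
    obtain ⟨ε₂, hε₂, H₂⟩ := h.vct_of_mem haM hβ'S hβ'ns h0
    set G₂ : termFnRing f n := ((P.eraseLead).map (chain f n g j).subtype).eval Y with hG₂
    have hG₂deg : DegLT (chain f n g j) Y G₂ s := by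
      refine degLT_eval (lt_of_le_of_lt (eraseLead_natDegree_le P) ?_)
      have := h.hPs; have := h.hs; omega
    have hsplit : G = G₂ + a * Y ^ s := by
      have e := congrArg (fun Q : Polynomial (chain f n g j) => (Q.map (chain f n g j).subtype).eval Y)
        (eraseLead_add_monomial_natDegree_leadingCoeff P)
      simp only [Polynomial.map_add, Polynomial.map_monomial, eval_add, eval_monomial, hPG, h.hPs] at e
      rw [← e]
      rfl
    have hG₂β' : ((G₂ : termFnRing f n) : (Fin n → K) → K) β' = 0 := by
      have e : ((G : termFnRing f n) : (Fin n → K) → K) β' =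
          (((G₂ + a * Y ^ s : termFnRing f n)) : (Fin n → K) → K) β' := by rw [← hsplit]
      rw [hGβ'] at e
      push_cast at e
      rw [Pi.add_apply, Pi.mul_apply, Pi.pow_apply, h0, zero_mul, add_zero] at e
      exact e.symm
    obtain ⟨ε₃, hε₃, H₃⟩ := h.hmin G₂ β' hG₂deg hβ'S hβ'ns hG₂β'
    have hGvct : VCT f n G F β' := by
      refine ⟨min ε₂ ε₃, lt_min hε₂ hε₃, fun x hx hV => ?_⟩
      rw [hsplit]
      push_cast
      rw [Pi.add_apply, Pi.mul_apply, Pi.pow_apply, H₂ x (lt_of_lt_of_le hx (min_le_left _ _)) hV,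
        H₃ x (lt_of_lt_of_le hx (min_le_right _ _)) hV, zero_mul, add_zero]
    exact not_linearIndependent_snoc_of_vct hβ'F hGvct hLI
  obtain ⟨ε₄, hε₄, H₄⟩ := exists_ball_ne_zero' a β' haβ'
  refine ⟨min ε₁ ε₄, lt_min hε₁ hε₄, fun x hx hV => ?_⟩
  obtain ⟨hxF, hGx⟩ := mem_VF_snoc.1 hV
  have e := hevalx x
  rw [hGx, mul_zero, zero_add, H₁ x (lt_of_lt_of_le hx (min_le_left _ _)) hxF] at e
  exact (mul_eq_zero.1 e).resolve_left (pow_ne_zero _ (H₄ x (lt_of_lt_of_le hx (min_le_right _ _))))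

end MinBad

/-- **The extension step of the proof of Lemma 1** (Wilkie 1989, pp. 391–395, Case 2): if the
system `F` of `p < n` functions in `Mⱼ` satisfies (3)ⱼ but not (3)ⱼ₊₁, then it extends by one
function `G ∈ Mⱼ₊₁` to a system satisfying (2)ⱼ₊₁ (at a point of `S`) and (3)ⱼ₊₁. [cite: Wilkie1989, proof of Lemma 1, pp. 391–395] -/
theorem lemma1_step (hg : ∀ i, n ≤ i → g i ∈ chain f n g i) (hpn : p < n)
    (hF : ∀ r, F r ∈ chain f n g j) (h3 : Clause3 S g j F) (hfail : ¬ Clause3 S g (j + 1) F) :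
    ∃ G : termFnRing f n, G ∈ chain f n g (j + 1) ∧ (∃ α ∈ S, α ∈ VnsF f n (Fin.snoc F G)) ∧
      Clause3 S g (j + 1) (Fin.snoc F G) := by
  obtain ⟨G, β, P, s, h⟩ := MinBad.exists hpn hF h3 hfail
  refine ⟨G, ?_, ⟨β, h.hβS, h.mem_VnsF_snoc hg⟩, h.clause3_snoc⟩
  rw [← h.hPG]
  exact (mem_chain_succ f n g).2 ⟨P, rfl⟩

end Step

/-! ### The induction: a good system with the maximal number of equations -/

section Assembly

variable {f n}
variable (S : Set (Fin n → K)) (g : ℕ → termFnRing f n)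

/-- A **good system at stage `j`**: `p ≤ n` functions of `Mⱼ` satisfying (2) ("for some `ᾱ ∈ S`,
`h₁(ᾱ) = ⋯ = hₚ(ᾱ) = 0` and `(dh₁ ∧ ⋯ ∧ dhₚ)(ᾱ) ≠ 0`") and (3)ⱼ or `p = n`. [cite: Wilkie1989, Lemma 1] -/
def GoodSys (j : ℕ) {p : ℕ} (F : Fin p → termFnRing f n) : Prop :=
  p ≤ n ∧ (∀ r, F r ∈ chain f n g j) ∧ (∃ α ∈ S, α ∈ VnsF f n F) ∧ (p = n ∨ Clause3 S g j F)

variable {S g}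

/-- The empty system is good at stage `0` ("it being trivial for `j = 0`", p. 391: `M₀ = k`, and a
constant vanishing at a point vanishes everywhere). [cite: Wilkie1989, proof of Lemma 1, p. 391] -/
theorem goodSys_zero (hS : S.Nonempty) : GoodSys S g 0 (Fin.elim0 : Fin 0 → termFnRing f n) := by
  obtain ⟨α, hα⟩ := hS
  refine ⟨Nat.zero_le _, fun r => r.elim0, ⟨α, hα, fun r => r.elim0, linearIndependent_empty_type⟩,
    Or.inr ?_⟩
  intro β _ _ G hG hGβ
  obtain ⟨c, rfl⟩ := (mem_chain_zero f n g).1 hG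
  refine ⟨1, one_pos, fun x _ _ => ?_⟩
  rw [coe_constFn] at hGβ ⊢
  exact hGβ

/-- **A good system with the maximal number of equations satisfies (3)ⱼ at every later stage**
(else the extension step would produce a good system with more equations; this is the content of
"for some `J₀`, Case 1 must hold for all `j ≥ J₀`", p. 395). [cite: Wilkie1989, proof of Lemma 1, p. 395] -/
theorem clause3_of_maximal (hg : ∀ i, n ≤ i → g i ∈ chain f n g i) {j₀ p : ℕ}
    {F : Fin p → termFnRing f n} (hgood : GoodSys S g j₀ F)
    (hmax : ∀ (j q : ℕ) (F' : Fin q → termFnRing f n), GoodSys S g j F' → q ≤ p) (hpn : p < n) :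
    ∀ j, j₀ ≤ j → Clause3 S g j F := by
  intro j hj
  induction j with
  | zero =>
    obtain rfl : j₀ = 0 := Nat.le_zero.1 hj
    exact hgood.2.2.2.resolve_left hpn.ne
  | succ j ih =>
    rcases Nat.of_le_succ hj with hle | heq
    · have h3 := ih hle
      by_contra hfail
      have hF : ∀ r, F r ∈ chain f n g j := fun r => chain_mono f n g hle (hgood.2.1 r)
      obtain ⟨G, hG, h2, h3'⟩ := lemma1_step hg hpn hF h3 hfail
      have hgood' : GoodSys S g (j + 1) (Fin.snoc F G) := by
        refine ⟨hpn, fun r => ?_, h2, Or.inr h3'⟩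
        refine Fin.lastCases ?_ (fun r => ?_) r
        · simpa using hG
        · simpa using chain_le_succ f n g j (hF r)
      have := hmax (j + 1) (p + 1) _ hgood'
      omega
    · subst heq
      exact hgood.2.2.2.resolve_left hpn.ne

/-- **Lemma 1 for term functions** (Wilkie 1989, p. 391, clauses (2) and (3)): there is a system of
`p ≤ n` term functions with a non-singular zero in `S` such that either `p = n` or (3) holds at
every stage, i.e. for all of `k[x̄]ᵉ = ⋃ⱼ Mⱼ`. [cite: Wilkie1989, Lemma 1] -/
theorem lemma1_main (hg : ∀ i, n ≤ i → g i ∈ chain f n g i) (hS : S.Nonempty) :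
    ∃ (p : ℕ) (F : Fin p → termFnRing f n), p ≤ n ∧ (∃ j₀, ∀ r, F r ∈ chain f n g j₀) ∧
      (∃ α ∈ S, α ∈ VnsF f n F) ∧ (p = n ∨ ∀ j, Clause3 S g j F) := by
  classical
  let Pq : ℕ → Prop := fun q => ∃ (j : ℕ) (F : Fin q → termFnRing f n), GoodSys S g j F
  have h0 : Pq 0 := ⟨0, Fin.elim0, goodSys_zero hS⟩
  set p := Nat.findGreatest Pq n with hp
  have hPp : Pq p := Nat.findGreatest_spec (Nat.zero_le n) h0
  obtain ⟨j₀, F, hgood⟩ := hPp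
  have hmax : ∀ (j q : ℕ) (F' : Fin q → termFnRing f n), GoodSys S g j F' → q ≤ p :=
    fun j q F' hg' => Nat.le_findGreatest hg'.1 ⟨j, F', hg'⟩
  refine ⟨p, F, hgood.1, ⟨j₀, hgood.2.1⟩, hgood.2.2.1, ?_⟩
  rcases eq_or_lt_of_le hgood.1 with hpn | hpn
  · exact Or.inl hpn
  · refine Or.inr fun j => ?_
    rcases le_or_gt j₀ j with hj | hj
    · exact clause3_of_maximal hg hgood hmax hpn j hj
    · -- earlier stages: `Mⱼ ⊆ Mⱼ₀`
      intro β hβS hβV G hG hGβ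
      exact clause3_of_maximal hg hgood hmax hpn j₀ le_rfl β hβS hβV G (chain_mono f n g hj.le hG) hGβ

end Assembly

/-! ### The discharges -/

/-- **Wilkie 1989, Lemma 1 (clauses (2), (3)): proved** (pp. 391–395). [cite: Wilkie1989, Lemma 1 (proof, pp. 391–395)] -/
theorem _root_.Literature.ModelTheory.ExponentialFields.Wilkie1989_lemma1_holds : Wilkie1989_lemma1 := by
  intro k K f hk n _hn S hS
  haveI := hk
  obtain ⟨p, F, hpn, -, ⟨α, hαS, hαV⟩, h3⟩ :=
    lemma1_main (S := S) (g := towerExp f n) (fun i _ => towerExp_mem f n i) hS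
  set t : Fin p → Language.orderedExpRing.Term (k ⊕ Fin n) := fun r => reprTerm f n (F r) with htdef
  have ht : ∀ r, fnOf f n (t r) = F r := fun r => Subtype.ext (termFn_reprTerm f n (F r))
  refine ⟨p, t, hpn, ⟨α, hαS, by rwa [← VnsF_eq_nonsingularZeroSet ht]⟩, ?_⟩
  rcases h3 with h | h
  · exact Or.inl h
  · refine Or.inr fun β hβS hβV t' ht'β => ?_
    rw [← VnsF_eq_nonsingularZeroSet ht] at hβV
    obtain ⟨j, hj⟩ := exists_mem_chain_towerExp f n t'
    exact (vct_iff_vanishesCloseTo ht t' β).1 (h j β hβS hβV (fnOf f n t') hj ht'β)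

/-- **Wilkie 1989, Lemma 3: proved** ("Suppose `F ∈ k[x̄]ᵉ` and `V(F) ≠ ∅`. Then `V(F)` contains an
e.a. point of `Kⁿ` over `k`"; from Lemma 1 by `Wilkie1989_lemma3_of_lemma1`). [cite: Wilkie1989, Lemma 3] -/
theorem _root_.Literature.ModelTheory.ExponentialFields.Wilkie1989_lemma3_holds : Wilkie1989_lemma3 :=
  Wilkie1989_lemma3_of_lemma1 Wilkie1989_lemma1_holds

/-- **Wilkie 1989, Corollary 1: proved** ("if all e.a. points of `Kⁿ` over `k` lie in `kⁿ` then
`k ≼₁ K`"; from Lemma 3 by `Wilkie1989_cor1_of_lemma3`). [cite: Wilkie1989, Corollary 1] -/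
theorem _root_.Literature.ModelTheory.ExponentialFields.Wilkie1989_cor1_holds : Wilkie1989_cor1 :=
  Wilkie1989_cor1_of_lemma3 Wilkie1989_lemma3_holds

/-- **Wilkie 1989, Theorem 2, from the statement of §5 alone** (the remaining leaf of the 1989
paper in the decomposition). [cite: Wilkie1989, §5, p. 399] -/
theorem _root_.Literature.ModelTheory.ExponentialFields.Wilkie1989_thm2_of_mem (hm : Wilkie1989_expAlgebraicPoints_mem) :
    Wilkie1989_existentiallyClosed_of_bounded :=
  Wilkie1989_thm2_of_lemma3_of_mem Wilkie1989_lemma3_holds hm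


end RealExpModel

end Literature.ModelTheory.ExponentialFields
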